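import Literature.Computability.QuantumComplexity.GluedTreesThm9View
import Mathlib.Data.Fintype.BigOperators
import HarnessLib

/-!
# Glued trees, Theorem 9 (classical lower bound) — fibres, the coupling, and the MASTER inequality

This module concatenates 3 parts of the proof of `ChildsEtAl2003_thm9`, each with its own
module docstring below: part `Fibre`, part `Coupling`, part `Master`.
-/
/-!
# Glued trees, Theorem 9 (classical lower bound) — V: the fibres of the coupling

Theorem-only support file for `ChildsEtAl2003_thm9`: the counting half of the coupling between
Game 1 (a uniformly random outcome `(σ, ν)`) and Game 5 (uniformly random coins and `σ`), i.e.
the quantitative content of Lemmas 4 and 7 of the source (pp. 11–12).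

* Consequences of `realizes` for an outcome consistent with a good view: the embedding is proper
  (`proper_of_cons`); the next round is classified — a wrong-length or repeated query or an
  unknown non-name is answered well and is not the EXIT's name (`next_*`), a first query of a
  known node is answered badly only if the physical expansion makes the extended embedding
  improper (`not_proper_append_of_stepState_none`), and an unknown string that IS a name (a lucky
  guess, Lemma 4) names a vertex outside the embedded tree (`guess_vertex`).
* `card_le_descFactorial_of_restrict`: namings that agree with a fixed assignment on a set of
  vertices and avoid a fixed set of names elsewhere are at most `(K - |Q|)_(|V| - |P|)`.
* `card_fibre_le_ext`, `card_fibre_guess_mul_le`: for fixed `σ`, good view and coins, the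
  consistent namings with these coins number at most `ext s` (and make the embedding proper),
  and those that moreover turn a fixed unknown string into a name number at most
  `ext s · (|V| - 2E - 1)/(K - 2E - 1 - |inv|)` (Lemma 4's `t · (2^{n+2} - 2)/2^{2n}`).
* `card_coins_agree`, `sum_card_filter_agree`: summing over the free coins.

## References

* [ChildsEtAl2003] A. M. Childs et al., Exponential algorithmic speedup by a quantum walk,
  STOC 2003, §4 (Lemmas 4 and 7).
-/

open Literature.Computability.Complexity

namespace Literature.Computability.QuantumComplexity

namespace GluedTrees

open Finset

variable {n : ℕ} {β : Type}

/-! ### Consequences of the simulation theorem -/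

section Consequences

variable (hn : 1 ≤ n) (σ : CycleDatum n) (ν : Vertex n ↪ Name n) (hν : ν (entrance n) = fun _ ↦ false)
  (M : OracleAlg β) (x : List Bool) {as : List (List Bool)} {s : VState n}
  (hs : viewState M x as = some s) (hcons : Cons M x (strOracle σ ν) as)

include hn hν hs hcons

/-- The embedding of a realised view is proper, for any coins agreeing with the realised ones.
[cite: ChildsEtAl2003, §4 (Lemma 7)] -/
theorem proper_of_cons {c : ℕ → Bool} (hc : ∀ i < s.par.length, coinsOf σ ν s i = c i) :
    Proper σ s.par c := by
  obtain ⟨R1, -, -, -, -⟩ := realizes hn σ ν hν M x as s hs hcons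
  obtain ⟨⟨-, hval⟩, hinj, -, -, -⟩ := viewState_wf M x as s hs
  intro m hm m' hm' h
  simp only [Set.mem_setOf_eq] at hm hm'
  rw [← pos_congr_coins σ s.par hval hc, ← pos_congr_coins σ s.par hval hc] at h
  have h1 := R1 m hm
  have h2 := R1 m' hm'
  rw [h] at h1
  exact hinj m hm m' hm' (h1.symm.trans h2)

omit hn hν hs hcons in
/-- A query of the wrong length is answered `[]`, is not the EXIT's name, and the view stays good.
[cite: ChildsEtAl2003, §4 (Game 2)] -/
theorem next_of_length_ne {q : List Bool} (hq : q.length ≠ 2 * n) :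
    strOracle σ ν q = [] ∧ q ≠ List.ofFn (ν (exit n)) ∧ s.stepState q (strOracle σ ν q) = some s := by
  refine ⟨strOracle_of_length_ne σ ν hq, fun h ↦ hq (by rw [h, List.length_ofFn]), ?_⟩
  rw [strOracle_of_length_ne σ ν hq]
  exact VState.stepState_of_length_ne s hq

/-- A repeated query (the name of an expanded node) is answered by its recorded answer, is not
the EXIT's name, and the view stays good. [cite: ChildsEtAl2003, §4 (Games 2–3)] -/
theorem next_of_mem_par {q : List Bool} (hq : q.length = 2 * n) {p : ℕ}
    (hp : s.nodeOf? (nameOfStr n q) = some p) (hmem : p ∈ s.par) :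
    strOracle σ ν q = encL (canon (s.answerSet (s.par.idxOf p) p)) ∧ q ≠ List.ofFn (ν (exit n)) ∧
      s.stepState q (strOracle σ ν q) = some s := by
  obtain ⟨R1, -, -, R4, R5⟩ := realizes hn σ ν hν M x as s hs hcons
  obtain ⟨⟨hnd, hval⟩, -, -, -, -⟩ := viewState_wf M x as s hs
  obtain ⟨hpE, hpl⟩ := VState.nodeOf?_eq_some hp
  set P := pos σ s.par (coinsOf σ ν s) with hP
  have hq_eq : q = List.ofFn (ν (P p)) := by rw [R1 p hpE, hpl, ofFn_nameOfStr hq]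
  set j := s.par.idxOf p with hj
  have hjlt : j < s.par.length := List.idxOf_lt_length_of_mem hmem
  have hpj : s.par[j] = p := List.idxOf_get hjlt
  have hans : strOracle σ ν q = encL (canon (s.answerSet j p)) := by
    rw [hq_eq, strOracle_apply_name]
    congr 2
    have h5 := R5 j hjlt
    rw [hpj] at h5
    rw [h5, VState.answerSet]
    by_cases hp0 : p = 0
    · simp only [hp0, if_true, Finset.empty_union]
      rw [hp0] at h5
      simp [Finset.map_insert, R1 _ (show 2 * j + 1 ≤ 2 * s.E by unfold VState.E; omega),
        R1 _ (show 2 * j + 2 ≤ 2 * s.E by unfold VState.E; omega)]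
    · simp only [hp0, if_false]
      rw [Finset.map_union, Finset.map_singleton, Finset.map_insert, Finset.map_singleton,
        R1 _ (VState.parentNode_le hval hpE),
        R1 _ (show 2 * j + 1 ≤ 2 * s.E by unfold VState.E; omega),
        R1 _ (show 2 * j + 2 ≤ 2 * s.E by unfold VState.E; omega)]
  refine ⟨hans, ?_, ?_⟩
  · rw [hq_eq]
    intro h
    have h' : P p = exit n := ν.injective (List.ofFn_injective h)
    by_cases hp0 : p = 0
    · rw [hp0, hP, pos_zero] at h'
      exact entrance_ne_exit n h'
    · have := R4 j hjlt (by rw [hpj]; exact hp0)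
      rw [hpj, h'] at this
      exact this rfl
  · rw [hans]
    exact VState.stepState_of_mem_par s hq hp hmem

omit hν hs hcons in
/-- An unknown `2n`-bit string answered INVALID is not the EXIT's name and the view stays good
(with the string recorded). [cite: ChildsEtAl2003, §4 (Game 2)] -/
theorem next_of_invalid {q : List Bool} (hq : q.length = 2 * n)
    (hp : s.nodeOf? (nameOfStr n q) = none) (hO : strOracle σ ν q = []) :
    q ≠ List.ofFn (ν (exit n)) ∧ s.stepState q (strOracle σ ν q) = some (s.addInv (nameOfStr n q)) := by
  refine ⟨?_, by rw [hO]; exact VState.stepState_of_nodeOf?_eq_none s hq hp⟩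
  intro h
  rw [h] at hO
  exact strOracle_apply_name_ne_nil hn σ ν (exit n) hO

/-- **Lucky guesses name vertices outside the tree.** An unknown `2n`-bit string with a
non-INVALID answer is the name of a vertex which is not the position of any node.
[cite: ChildsEtAl2003, §4 (Lemma 4)] -/
theorem guess_vertex {q : List Bool} (hq : q.length = 2 * n)
    (hp : s.nodeOf? (nameOfStr n q) = none) (hO : strOracle σ ν q ≠ []) :
    ∃ v, ν v = nameOfStr n q ∧ ∀ m ≤ 2 * s.E, v ≠ pos σ s.par (coinsOf σ ν s) m := by
  obtain ⟨R1, -, -, -, -⟩ := realizes hn σ ν hν M x as s hs hcons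
  by_cases h : ∃ v, ν v = nameOfStr n q
  · obtain ⟨v, hv⟩ := h
    refine ⟨v, hv, fun m hm hvm ↦ ?_⟩
    have := VState.nodeOf?_eq_none.mp hp m hm
    rw [← R1 m hm, ← hvm, hv] at this
    exact this rfl
  · exact absurd (strOracle_of_not_isName σ ν hq h) hO

/-- **A bad expansion answer makes the extended embedding improper** (for every value of the
new coin): if the first query of the known unexpanded node `p` is NOT answered by a good
expansion answer, then the two onward options of its position are too few or hit the tree.
[cite: ChildsEtAl2003, §4 (Games 3–5)] -/
theorem not_proper_append_of_stepState_none {q : List Bool} (hq : q.length = 2 * n) {p : ℕ}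
    (hp : s.nodeOf? (nameOfStr n q) = some p) (hmem : p ∉ s.par)
    (hnone : s.stepState q (strOracle σ ν q) = none)
    {c : ℕ → Bool} (hc : ∀ i < s.par.length, coinsOf σ ν s i = c i) :
    ¬ Proper σ (s.par ++ [p]) c := by
  obtain ⟨R1, R2, R3, -, -⟩ := realizes hn σ ν hν M x as s hs hcons
  obtain ⟨⟨hnd, hval⟩, hinj, hdis, -, -⟩ := viewState_wf M x as s hs
  obtain ⟨hpE, hpl⟩ := VState.nodeOf?_eq_some hp
  -- positions under `c` agree with the realised ones
  have hPc : ∀ m, pos σ s.par c m = pos σ s.par (coinsOf σ ν s) m :=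
    fun m ↦ (pos_congr_coins σ s.par hval hc m).symm
  set P := pos σ s.par (coinsOf σ ν s) with hP
  have hq_eq : q = List.ofFn (ν (P p)) := by rw [R1 p hpE, hpl, ofFn_nameOfStr hq]
  have hOq : strOracle σ ν q = encL (canon (((graph n σ).neighborFinset (P p)).map ν)) := by
    rw [hq_eq, strOracle_apply_name]
  -- the entering vertex and the options
  set u : Option (Vertex n) := if p = 0 then none else some (P (s.parentNode p)) with hu
  set os := stepOpts σ (P p) u with hos
  have hpar_le : s.parentNode p ≤ 2 * s.E := VState.parentNode_le hval hpE
  have hadj : p ≠ 0 → P (s.parentNode p) ∈ (graph n σ).neighborFinset (P p) := fun hp0 ↦ by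
    rw [SimpleGraph.mem_neighborFinset, SimpleGraph.adj_comm, ← SimpleGraph.mem_neighborFinset]
    exact R3 p (by omega) hpE
  have hos_spec : os.toFinset = (if p = 0 then (graph n σ).neighborFinset (P p)
      else ((graph n σ).neighborFinset (P p)).erase (P (s.parentNode p))) ∧ os.Nodup := by
    by_cases hp0 : p = 0
    · have hPp : P p = entrance n := by rw [hp0, hP, pos_zero]
      have hu0 : u = none := by simp [hu, hp0]
      rw [hos, hu0, if_pos hp0, hPp]
      exact ⟨(stepOpts_entrance_none hn σ).1, (stepOpts_entrance_none hn σ).2.1⟩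
    · simp only [hos, hu, hp0, if_false]
      exact stepOpts_toFinset hn σ (hadj hp0)
  -- the new positions, for the coins `c`
  have hpos' := pos_append_singleton σ s.par p (c := c) (c' := c) hval (fun _ _ ↦ rfl) hpE
  have hparE : s.par.getD ((p - 1) / 2) 0 = s.parentNode p := rfl
  rw [hparE] at hpos'
  have hos' : stepOpts σ (pos σ s.par c p) (if p = 0 then none else some (pos σ s.par c (s.parentNode p))) = os := by
    rw [hPc, hPc]
  rw [hos'] at hpos'
  -- suppose the extended embedding were proper: then both options are fresh vertices
  intro hprop
  have hE1 : (s.par ++ [p]).length = s.par.length + 1 := by simp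
  have hnew1 : pos σ (s.par ++ [p]) c (2 * s.par.length + 1) = os.getD (if c s.par.length then 1 else 0) (entrance n) := by
    rw [hpos', Function.update_of_ne (by omega), Function.update_self]
  have hnew2 : pos σ (s.par ++ [p]) c (2 * s.par.length + 2) = os.getD (if c s.par.length then 0 else 1) (entrance n) := by
    rw [hpos', Function.update_self]
  have hold : ∀ m ≤ 2 * s.par.length, pos σ (s.par ++ [p]) c m = P m := by
    intro m hm
    rw [hpos', Function.update_of_ne (by omega), Function.update_of_ne (by omega), hPc]
  -- both option slots are genuine (not the ENTRANCE default) and distinct from all old positions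
  have hslot : ∀ i ∈ ({0, 1} : Finset ℕ), ∃ w, os[i]? = some w ∧ ∀ m ≤ 2 * s.E, w ≠ P m := by
    intro i hi
    simp only [Finset.mem_insert, Finset.mem_singleton] at hi
    -- the node `k` of the tree placed at slot `i`
    obtain ⟨k, hk, hkpos⟩ : ∃ k, (k = 2 * s.par.length + 1 ∨ k = 2 * s.par.length + 2) ∧
        pos σ (s.par ++ [p]) c k = os.getD i (entrance n) := by
      rcases hi with rfl | rfl
      · by_cases hcb : c s.par.length
        · exact ⟨_, Or.inr rfl, by rw [hnew2, if_pos hcb]⟩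
        · exact ⟨_, Or.inl rfl, by rw [hnew1, if_neg hcb]⟩
      · by_cases hcb : c s.par.length
        · exact ⟨_, Or.inl rfl, by rw [hnew1, if_pos hcb]⟩
        · exact ⟨_, Or.inr rfl, by rw [hnew2, if_neg hcb]⟩
    have hkS : k ∈ {m | m ≤ 2 * (s.par ++ [p]).length} := by
      simp only [Set.mem_setOf_eq, hE1]; omega
    have hk0 : k ≠ 0 := by omega
    cases hget : os[i]? with
    | none =>
      -- the slot is empty: node `k` sits at the ENTRANCE, like the root
      exfalso
      rw [List.getD_eq_getElem?_getD, hget, Option.getD_none] at hkpos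
      have h0S : (0 : ℕ) ∈ {m | m ≤ 2 * (s.par ++ [p]).length} := by simp
      have := hprop hkS h0S (by rw [hkpos, pos_zero])
      exact hk0 this
    | some w =>
      refine ⟨w, rfl, fun m hm hwm ↦ ?_⟩
      rw [List.getD_eq_getElem?_getD, hget, Option.getD_some] at hkpos
      have hmS : m ∈ {m | m ≤ 2 * (s.par ++ [p]).length} := by
        simp only [Set.mem_setOf_eq, hE1]; unfold VState.E at hm; omega
      have := hprop hkS hmS (by rw [hkpos, hwm, hold m (by unfold VState.E at hm; omega)])
      unfold VState.E at hm
      omega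
  -- hence the real answer IS a good expansion answer: contradiction with `hnone`
  obtain ⟨w0, hw0, hw0f⟩ := hslot 0 (by simp)
  obtain ⟨w1, hw1, hw1f⟩ := hslot 1 (by simp)
  have hlen : os.length = 2 := by
    have h2 : 2 ≤ os.length := by
      by_contra hlt
      rw [not_le] at hlt
      have : os[1]? = none := List.getElem?_eq_none (by omega)
      rw [this] at hw1; exact absurd hw1 (by simp)
    have h3 : os.length ≤ 2 := by
      rw [← List.toFinset_card_of_nodup hos_spec.2, hos_spec.1]
      split_ifs with hp0
      · have hPp : P p = entrance n := by rw [hp0, hP, pos_zero]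
        rw [hPp, SimpleGraph.card_neighborFinset_eq_degree, degree_eq hn σ, if_pos depth_entrance]
      · rw [Finset.card_erase_of_mem (hadj hp0), SimpleGraph.card_neighborFinset_eq_degree, degree_eq hn σ]
        split_ifs <;> omega
    omega
  obtain ⟨o₀, o₁, hos01⟩ := List.length_eq_two.mp hlen
  rw [hos01] at hw0 hw1
  simp only [List.getElem?_cons_zero, Option.some.injEq, List.getElem?_cons_succ] at hw0 hw1
  subst hw0; subst hw1
  -- the good answer
  set S := ((graph n σ).neighborFinset (P p)).map ν with hS
  have hF : s.freshSet p (canon S) = (os.toFinset).map ν := by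
    rw [VState.freshSet_canon, hos_spec.1]
    by_cases hp0 : p = 0
    · simp [hp0, hS]
    · simp only [hp0, if_false, hS]
      rw [Finset.map_erase, R1 _ hpar_le]
  have hcard : (s.freshSet p (canon S)).card = 2 := by
    rw [hF, Finset.card_map, List.toFinset_card_of_nodup hos_spec.2, hlen]
  have hparent : p ≠ 0 → s.label (s.parentNode p) ∈ S := fun hp0 ↦ by
    rw [hS, ← R1 _ hpar_le]
    exact Finset.mem_map_of_mem ν (hadj hp0)
  have hfresh : ∀ b ∈ s.freshSet p (canon S), s.nodeOf? b = none ∧ b ∉ s.inv := by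
    intro b hb
    rw [hF, Finset.mem_map] at hb
    obtain ⟨w, hw, rfl⟩ := hb
    rw [List.mem_toFinset, hos01] at hw
    simp only [List.mem_cons, List.not_mem_nil, or_false] at hw
    refine ⟨?_, fun hb ↦ R2 _ hb w rfl⟩
    rw [VState.nodeOf?_eq_none]
    intro m hm hlab
    rw [← R1 m hm] at hlab
    have hmw : pos σ s.par (coinsOf σ ν s) m = w := ν.injective hlab
    rcases hw with rfl | rfl
    · exact hw0f m hm hmw.symm
    · exact hw1f m hm hmw.symm
  have := VState.stepState_expand hn s hq hp hmem S hcard hparent hfresh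
  rw [← hOq] at this
  rw [this] at hnone
  exact absurd hnone (by simp)

/-- A good expansion answer is not the EXIT's name (the EXIT has only two neighbours).
[cite: ChildsEtAl2003, §4 (Game 3)] -/
theorem next_expand_ne_exit {q : List Bool} (hq : q.length = 2 * n) {p : ℕ}
    (hp : s.nodeOf? (nameOfStr n q) = some p) (hmem : p ∉ s.par) {s' : VState n}
    (hsome : s.stepState q (strOracle σ ν q) = some s') :
    q ≠ List.ofFn (ν (exit n)) ∧ s' = s.expand p (s.freshSet p (canon (((graph n σ).neighborFinset
      (pos σ s.par (coinsOf σ ν s) p)).map ν))) (nameOfStr n q) ∧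
      (s.freshSet p (canon (((graph n σ).neighborFinset (pos σ s.par (coinsOf σ ν s) p)).map ν))).card = 2 := by
  obtain ⟨R1, -, R3, -, -⟩ := realizes hn σ ν hν M x as s hs hcons
  obtain ⟨⟨hnd, hval⟩, -, -, -, -⟩ := viewState_wf M x as s hs
  obtain ⟨hpE, hpl⟩ := VState.nodeOf?_eq_some hp
  set P := pos σ s.par (coinsOf σ ν s) with hP
  have hq_eq : q = List.ofFn (ν (P p)) := by rw [R1 p hpE, hpl, ofFn_nameOfStr hq]
  have hOq : strOracle σ ν q = encL (canon (((graph n σ).neighborFinset (P p)).map ν)) := by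
    rw [hq_eq, strOracle_apply_name]
  rcases VState.stepState_cases hsome with ⟨hql, -, -⟩ | ⟨-, m, hm, hmp, -, -⟩ |
      ⟨-, m, L, hm, -, hL, -, hcard, -, -, rfl⟩ | ⟨-, hm, -, -⟩
  · exact absurd hq hql
  · rw [hp] at hm; cases hm; exact absurd hmp hmem
  · rw [hp] at hm
    cases hm
    rw [hOq, decL_encL hn] at hL
    cases hL
    refine ⟨?_, rfl, hcard⟩
    rw [hq_eq]
    intro h
    have h' : P p = exit n := ν.injective (List.ofFn_injective h)
    -- the fresh set has two elements, so `P p` has three neighbours (or is the ENTRANCE)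
    by_cases hp0 : p = 0
    · rw [hp0, hP, pos_zero] at h'
      exact entrance_ne_exit n h'
    · rw [VState.freshSet_canon, if_neg hp0] at hcard
      have hpar_le : s.parentNode p ≤ 2 * s.E := VState.parentNode_le hval hpE
      have hadj : P (s.parentNode p) ∈ (graph n σ).neighborFinset (P p) := by
        rw [SimpleGraph.mem_neighborFinset, SimpleGraph.adj_comm, ← SimpleGraph.mem_neighborFinset]
        exact R3 p (by omega) hpE
      rw [← R1 _ hpar_le, ← Finset.map_erase, Finset.card_map, Finset.card_erase_of_mem hadj,
        SimpleGraph.card_neighborFinset_eq_degree, degree_eq hn σ, h'] at hcard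
      simp at hcard
  · rw [hp] at hm; cases hm

end Consequences

/-! ### Counting namings by restriction -/

/-- **Restriction bound.** Namings that agree with a fixed assignment `g` on a set `PV` of
vertices and avoid a set `Q` of names outside `PV` are at most
`(4^n - |Q|)_(|V| - |PV|)` in number: restriction to the complement of `PV` is injective into
the injections `PVᶜ ↪ Qᶜ`. [cite: ChildsEtAl2003, §4 (Lemmas 4 and 7)] -/
theorem card_le_descFactorial_of_restrict (A : Finset (Naming n)) (PV : Finset (Vertex n))
    (Q : Finset (Name n)) (g : Vertex n → Name n)
    (hA : ∀ ν ∈ A, (∀ v ∈ PV, ν.1 v = g v) ∧ (∀ v ∉ PV, ν.1 v ∉ Q)) :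
    A.card ≤ (4 ^ n - Q.card).descFactorial (Fintype.card (Vertex n) - PV.card) := by
  classical
  -- the restriction map
  let Φ : A → ({v : Vertex n // v ∉ PV} ↪ {a : Name n // a ∉ Q}) := fun ν ↦
    ⟨fun v ↦ ⟨ν.1.1 v.1, (hA ν.1 ν.2).2 v.1 v.2⟩, fun v w h ↦ by
      apply Subtype.ext
      exact ν.1.1.injective (congrArg Subtype.val h)⟩
  have hΦ : Function.Injective Φ := by
    intro ν₁ ν₂ h
    apply Subtype.ext
    apply Subtype.ext
    apply DFunLike.ext
    intro v
    by_cases hv : v ∈ PV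
    · rw [(hA ν₁.1 ν₁.2).1 v hv, (hA ν₂.1 ν₂.2).1 v hv]
    · have := congrArg (fun φ : {v : Vertex n // v ∉ PV} ↪ {a : Name n // a ∉ Q} ↦ (φ ⟨v, hv⟩).1) h
      exact this
  have h1 := Fintype.card_le_of_injective Φ hΦ
  rw [Fintype.card_coe] at h1
  refine h1.trans (le_of_eq ?_)
  rw [Fintype.card_embedding_eq, Fintype.card_subtype_compl, Fintype.card_subtype_compl,
    Fintype.card_coe, Fintype.card_coe]
  congr 1
  rw [Fintype.card_fun, Fintype.card_fin, Fintype.card_bool, pow_mul]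
  norm_num

/-! ### The fibre bounds -/

section Fibre

variable (hn : 1 ≤ n) (σ : CycleDatum n) (M : OracleAlg β) (x : List Bool)
  {as : List (List Bool)} {s : VState n} (hs : viewState M x as = some s)

include hn hs

/-- **Fibre bound (Lemma 7, counting form).** For fixed `σ`, good view and coins `c`, the
namings consistent with the view whose realised coins are `c` number at most `ext s`.
[cite: ChildsEtAl2003, §4 (Lemma 7)] -/
theorem card_fibre_le_ext (c : ℕ → Bool) (A : Finset (Naming n))
    (hA : ∀ ν ∈ A, Cons M x (strOracle σ ν.1) as ∧ ∀ i < s.par.length, coinsOf σ ν.1 s i = c i) :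
    A.card ≤ s.ext := by
  classical
  obtain ⟨⟨hnd, hval⟩, hinj, hdis, -, -⟩ := viewState_wf M x as s hs
  set P := pos σ s.par c with hP
  set PV := (Finset.range (2 * s.E + 1)).image P with hPV
  set Q := (Finset.range (2 * s.E + 1)).image s.label ∪ s.inv with hQ
  have hR : ∀ ν ∈ A, (∀ m ≤ 2 * s.E, ν.1 (P m) = s.label m) ∧ (∀ a ∈ s.inv, ∀ v, ν.1 v ≠ a) := by
    intro ν hν
    obtain ⟨R1, R2, -, -, -⟩ := realizes hn σ ν.1 ν.2 M x as s hs (hA ν hν).1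
    refine ⟨fun m hm ↦ ?_, R2⟩
    rw [hP, ← pos_congr_coins σ s.par hval (hA ν hν).2 m]
    exact R1 m hm
  rcases A.eq_empty_or_nonempty with rfl | ⟨ν₀, hν₀⟩
  · simp
  -- cardinalities of `PV` and `Q`
  have hPinj : Set.InjOn P ↑(Finset.range (2 * s.E + 1)) := by
    intro m hm m' hm' h
    simp only [Finset.coe_range, Set.mem_Iio] at hm hm'
    have h1 := (hR ν₀ hν₀).1 m (by omega)
    have h2 := (hR ν₀ hν₀).1 m' (by omega)
    rw [h] at h1
    exact hinj m (by omega) m' (by omega) (h1.symm.trans h2)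
  have hLinj : Set.InjOn s.label ↑(Finset.range (2 * s.E + 1)) := by
    intro m hm m' hm' h
    simp only [Finset.coe_range, Set.mem_Iio] at hm hm'
    exact hinj m (by omega) m' (by omega) h
  have hPVcard : PV.card = 2 * s.E + 1 := by
    rw [hPV, Finset.card_image_of_injOn hPinj, Finset.card_range]
  have hQcard : Q.card = 2 * s.E + 1 + s.inv.card := by
    rw [hQ, Finset.card_union_of_disjoint, Finset.card_image_of_injOn hLinj, Finset.card_range]
    rw [Finset.disjoint_left]
    intro a ha
    rw [Finset.mem_image] at ha
    obtain ⟨m, hm, rfl⟩ := ha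
    rw [Finset.mem_range] at hm
    exact hdis m (by omega)
  -- the assignment on `PV`
  have hPV_le : PV.card ≤ Fintype.card (Vertex n) := Finset.card_le_univ PV
  let g : Vertex n → Name n := fun v ↦ if h : ∃ m ≤ 2 * s.E, P m = v then s.label h.choose else ν₀.1 v
  have hg : ∀ ν ∈ A, (∀ v ∈ PV, ν.1 v = g v) ∧ (∀ v ∉ PV, ν.1 v ∉ Q) := by
    intro ν hν
    constructor
    · intro v hv
      rw [hPV, Finset.mem_image] at hv
      obtain ⟨m, hm, rfl⟩ := hv
      rw [Finset.mem_range] at hm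
      have hex : ∃ m' ≤ 2 * s.E, P m' = P m := ⟨m, by omega, rfl⟩
      simp only [g, dif_pos hex]
      have h1 := hex.choose_spec
      rw [← (hR ν hν).1 _ h1.1, h1.2]
    · intro v hv hvQ
      rw [hQ, Finset.mem_union, Finset.mem_image] at hvQ
      rcases hvQ with ⟨m, hm, hml⟩ | hvinv
      · rw [Finset.mem_range] at hm
        rw [← (hR ν hν).1 m (by omega)] at hml
        have := ν.1.injective hml
        apply hv
        rw [hPV, Finset.mem_image]
        exact ⟨m, Finset.mem_range.mpr hm, this⟩
      · exact (hR ν hν).2 _ hvinv v rfl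
  have := card_le_descFactorial_of_restrict A PV Q g hg
  rw [hPVcard, hQcard] at this
  unfold VState.ext
  rw [if_pos (hPVcard ▸ hPV_le)]
  exact this

/-- **Guess bound (Lemma 4, counting form).** For fixed `σ`, good view, coins `c` and an unknown
non-INVALID `2n`-bit string `qa`, the consistent namings with coins `c` under which `qa` is
nevertheless a name satisfy `#A · (4^n - (2E+1) - |inv|) ≤ (|V| - (2E+1)) · ext s`.
[cite: ChildsEtAl2003, §4 (Lemma 4)] -/
theorem card_fibre_guess_mul_le (c : ℕ → Bool) (qa : Name n)
    (hqa : s.nodeOf? qa = none) (hqinv : qa ∉ s.inv) (A : Finset (Naming n))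
    (hA : ∀ ν ∈ A, Cons M x (strOracle σ ν.1) as ∧ (∀ i < s.par.length, coinsOf σ ν.1 s i = c i) ∧
      ∃ v, ν.1 v = qa) :
    A.card * (4 ^ n - (2 * s.E + 1 + s.inv.card)) ≤
      (Fintype.card (Vertex n) - (2 * s.E + 1)) * s.ext := by
  classical
  obtain ⟨⟨hnd, hval⟩, hinj, hdis, -, -⟩ := viewState_wf M x as s hs
  set P := pos σ s.par c with hP
  set PV := (Finset.range (2 * s.E + 1)).image P with hPV
  set Q := (Finset.range (2 * s.E + 1)).image s.label ∪ s.inv with hQ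
  have hR : ∀ ν ∈ A, (∀ m ≤ 2 * s.E, ν.1 (P m) = s.label m) ∧ (∀ a ∈ s.inv, ∀ v, ν.1 v ≠ a) := by
    intro ν hν
    obtain ⟨R1, R2, -, -, -⟩ := realizes hn σ ν.1 ν.2 M x as s hs (hA ν hν).1
    refine ⟨fun m hm ↦ ?_, R2⟩
    rw [hP, ← pos_congr_coins σ s.par hval (hA ν hν).2.1 m]
    exact R1 m hm
  rcases A.eq_empty_or_nonempty with rfl | ⟨ν₀, hν₀⟩
  · simp
  have hPinj : Set.InjOn P ↑(Finset.range (2 * s.E + 1)) := by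
    intro m hm m' hm' h
    simp only [Finset.coe_range, Set.mem_Iio] at hm hm'
    have h1 := (hR ν₀ hν₀).1 m (by omega)
    have h2 := (hR ν₀ hν₀).1 m' (by omega)
    rw [h] at h1
    exact hinj m (by omega) m' (by omega) (h1.symm.trans h2)
  have hLinj : Set.InjOn s.label ↑(Finset.range (2 * s.E + 1)) := by
    intro m hm m' hm' h
    simp only [Finset.coe_range, Set.mem_Iio] at hm hm'
    exact hinj m (by omega) m' (by omega) h
  have hPVcard : PV.card = 2 * s.E + 1 := by
    rw [hPV, Finset.card_image_of_injOn hPinj, Finset.card_range]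
  have hQcard : Q.card = 2 * s.E + 1 + s.inv.card := by
    rw [hQ, Finset.card_union_of_disjoint, Finset.card_image_of_injOn hLinj, Finset.card_range]
    rw [Finset.disjoint_left]
    intro a ha
    rw [Finset.mem_image] at ha
    obtain ⟨m, hm, rfl⟩ := ha
    rw [Finset.mem_range] at hm
    exact hdis m (by omega)
  have hqaQ : qa ∉ Q := by
    rw [hQ, Finset.mem_union, Finset.mem_image, not_or]
    refine ⟨?_, hqinv⟩
    rintro ⟨m, hm, hml⟩
    rw [Finset.mem_range] at hm
    exact VState.nodeOf?_eq_none.mp hqa m (by omega) hml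
  let g : Vertex n → Name n := fun v ↦ if h : ∃ m ≤ 2 * s.E, P m = v then s.label h.choose else ν₀.1 v
  have hg : ∀ ν ∈ A, (∀ v ∈ PV, ν.1 v = g v) ∧ (∀ v ∉ PV, ν.1 v ∉ Q) := by
    intro ν hν
    constructor
    · intro v hv
      rw [hPV, Finset.mem_image] at hv
      obtain ⟨m, hm, rfl⟩ := hv
      rw [Finset.mem_range] at hm
      have hex : ∃ m' ≤ 2 * s.E, P m' = P m := ⟨m, by omega, rfl⟩
      simp only [g, dif_pos hex]
      have h1 := hex.choose_spec
      rw [← (hR ν hν).1 _ h1.1, h1.2]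
    · intro v hv hvQ
      rw [hQ, Finset.mem_union, Finset.mem_image] at hvQ
      rcases hvQ with ⟨m, hm, hml⟩ | hvinv
      · rw [Finset.mem_range] at hm
        rw [← (hR ν hν).1 m (by omega)] at hml
        have := ν.1.injective hml
        apply hv
        rw [hPV, Finset.mem_image]
        exact ⟨m, Finset.mem_range.mpr hm, this⟩
      · exact (hR ν hν).2 _ hvinv v rfl
  -- split `A` according to the vertex named `qa` (always outside `PV`)
  have hvtx : ∀ ν ∈ A, vtx ν.1 qa ∉ PV ∧ ν.1 (vtx ν.1 qa) = qa := by
    intro ν hν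
    obtain ⟨v, hv⟩ := (hA ν hν).2.2
    have h1 : vtx ν.1 qa = v := by rw [← hv, vtx_apply]
    rw [h1]
    refine ⟨fun hvPV ↦ ?_, hv⟩
    have := (hg ν hν).1 v hvPV
    rw [hPV, Finset.mem_image] at hvPV
    obtain ⟨m, hm, rfl⟩ := hvPV
    rw [Finset.mem_range] at hm
    rw [(hR ν hν).1 m (by omega)] at hv
    exact VState.nodeOf?_eq_none.mp hqa m (by omega) hv
  have hsplit : A.card = ∑ v ∈ PVᶜ, (A.filter (fun ν ↦ vtx ν.1 qa = v)).card := by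
    rw [← Finset.card_biUnion]
    · congr 1
      ext ν
      simp only [Finset.mem_biUnion, Finset.mem_compl, Finset.mem_filter]
      constructor
      · intro hν; exact ⟨vtx ν.1 qa, (hvtx ν hν).1, hν, rfl⟩
      · rintro ⟨v, -, hν, -⟩; exact hν
    · intro v _ w _ hvw
      simp only [Function.onFun]
      rw [Finset.disjoint_left]
      intro ν h1 h2
      rw [Finset.mem_filter] at h1 h2
      exact hvw (h1.2.symm.trans h2.2)
  -- each part is bounded by the restriction lemma with one more fixed vertex and name
  have hpart : ∀ v ∈ PVᶜ, (A.filter (fun ν ↦ vtx ν.1 qa = v)).card ≤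
      (4 ^ n - (Q.card + 1)).descFactorial (Fintype.card (Vertex n) - (PV.card + 1)) := by
    intro v hv
    rw [Finset.mem_compl] at hv
    have h1 : (insert v PV).card = PV.card + 1 := Finset.card_insert_of_notMem hv
    have h2 : (insert qa Q).card = Q.card + 1 := Finset.card_insert_of_notMem hqaQ
    rw [← h1, ← h2]
    apply card_le_descFactorial_of_restrict _ _ _ (Function.update g v qa)
    intro ν hν
    rw [Finset.mem_filter] at hν
    obtain ⟨hνA, hνv⟩ := hν
    constructor
    · intro w hw
      rw [Finset.mem_insert] at hw
      rcases hw with rfl | hw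
      · rw [Function.update_self, ← hνv]; exact (hvtx ν hνA).2
      · rw [Function.update_of_ne (fun h : w = v ↦ hv (h ▸ hw))]; exact (hg ν hνA).1 w hw
    · intro w hw hwQ
      rw [Finset.mem_insert, not_or] at hw
      rw [Finset.mem_insert] at hwQ
      rcases hwQ with hwq | hwQ
      · apply hw.1
        rw [← hνv, ← hwq, vtx_apply]
      · exact (hg ν hνA).2 w hw.2 hwQ
  have hsum : A.card ≤ (PVᶜ).card * (4 ^ n - (Q.card + 1)).descFactorial (Fintype.card (Vertex n) - (PV.card + 1)) := by
    rw [hsplit]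
    have := Finset.sum_le_sum hpart
    rw [Finset.sum_const, smul_eq_mul] at this
    exact this
  rw [Finset.card_compl, hPVcard, hQcard] at hsum
  -- arithmetic: `N.descFactorial (k+1) = N * (N-1).descFactorial k` with `N = 4^n - Q.card`
  unfold VState.ext
  have hPV_le : 2 * s.E + 1 ≤ Fintype.card (Vertex n) := hPVcard ▸ Finset.card_le_univ PV
  rw [if_pos hPV_le]
  set N := 4 ^ n - (2 * s.E + 1 + s.inv.card) with hN
  set R := Fintype.card (Vertex n) - (2 * s.E + 1) with hR'
  have hN1 : 4 ^ n - (2 * s.E + 1 + s.inv.card + 1) = N - 1 := by omega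
  have hR1 : Fintype.card (Vertex n) - (2 * s.E + 1 + 1) = R - 1 := by omega
  rw [hN1, hR1] at hsum
  rcases Nat.eq_zero_or_pos R with hR0 | hRpos
  · -- no vertex outside the tree: `A` is empty
    rw [hR0, zero_mul] at hsum ⊢
    rw [Nat.le_zero.mp hsum, zero_mul]
  rcases Nat.eq_zero_or_pos N with hN0 | hNpos
  · rw [hN0]; simp
  calc A.card * N ≤ R * (N - 1).descFactorial (R - 1) * N := Nat.mul_le_mul_right N hsum
    _ = R * (N * (N - 1).descFactorial (R - 1)) := by ring
    _ = R * N.descFactorial R := by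
      congr 1
      have key := Nat.succ_descFactorial_succ (N - 1) (R - 1)
      rw [Nat.sub_add_cancel hNpos, Nat.sub_add_cancel hRpos] at key
      exact key.symm

end Fibre

/-! ### Summing over the free coins -/

/-- The number of coin vectors with `E ≤ t` prescribed coordinates is `2^(t-E)`. [folklore] -/
theorem card_coins_agree (t E : ℕ) (hE : E ≤ t) (b : ℕ → Bool) :
    (Finset.univ.filter (fun c : Fin t → Bool ↦ ∀ j : Fin t, (j : ℕ) < E → c j = b j)).card = 2 ^ (t - E) := by
  classical
  have hset : (Finset.univ.filter (fun c : Fin t → Bool ↦ ∀ j : Fin t, (j : ℕ) < E → c j = b j)) =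
      Fintype.piFinset (fun j : Fin t ↦ if (j : ℕ) < E then {b j} else Finset.univ) := by
    ext c
    simp only [Finset.mem_filter, Finset.mem_univ, true_and, Fintype.mem_piFinset]
    constructor
    · intro h j
      split_ifs with hj
      · rw [Finset.mem_singleton]; exact h j hj
      · exact Finset.mem_univ _
    · intro h j hj
      have := h j
      rw [if_pos hj, Finset.mem_singleton] at this
      exact this
  rw [hset, Fintype.card_piFinset]
  have : ∀ j : Fin t, (if (j : ℕ) < E then ({b j} : Finset Bool) else Finset.univ).card =
      if (j : ℕ) < E then 1 else 2 := by
    intro j; split_ifs <;> simp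
  simp_rw [this]
  rw [Finset.prod_ite, Finset.prod_const_one, one_mul, Finset.prod_const]
  congr 1
  -- the coordinates `≥ E` of `Fin t` number `t - E`
  rw [Finset.card_eq_of_equiv_fin]
  -- an explicit equivalence with `Fin (t - E)`
  refine
    { toFun := fun j ↦ ⟨(j.1 : ℕ) - E, by
        have := j.2; simp only [Finset.mem_filter, Finset.mem_univ, true_and, not_lt] at this
        have := j.1.isLt; omega⟩
      invFun := fun i ↦ ⟨⟨(i : ℕ) + E, by omega⟩, by simp⟩
      left_inv := fun j ↦ by
        have := j.2; simp only [Finset.mem_filter, Finset.mem_univ, true_and, not_lt] at this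
        apply Subtype.ext; apply Fin.ext; simp only; omega
      right_inv := fun i ↦ by apply Fin.ext; simp }

/-- **Double counting over the free coins**: summing, over all coin vectors `c`, the number of
elements of `S` whose realised coins agree with `c` below `E` counts every element `2^(t-E)`
times. [folklore] -/
theorem sum_card_filter_agree {ι : Type*} (S : Finset ι) (t E : ℕ) (hE : E ≤ t) (coin : ι → ℕ → Bool) :
    ∑ c : Fin t → Bool, (S.filter (fun i ↦ ∀ j : Fin t, (j : ℕ) < E → coin i j = c j)).card =
      2 ^ (t - E) * S.card := by
  classical
  simp_rw [Finset.card_filter]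
  rw [Finset.sum_comm]
  have : ∀ i ∈ S, (∑ c : Fin t → Bool, if ∀ j : Fin t, (j : ℕ) < E → coin i j = c j then 1 else 0) = 2 ^ (t - E) := by
    intro i _
    rw [← Finset.card_filter]
    have := card_coins_agree t E hE (coin i)
    convert this using 2
    ext c
    simp only [Finset.mem_filter, Finset.mem_univ, true_and]
    constructor <;> intro h j hj <;> exact (h j hj).symm
  rw [Finset.sum_congr rfl this, Finset.sum_const, smul_eq_mul, mul_comm]

end GluedTrees

end Literature.Computability.QuantumComplexity

/-!
# Glued trees, Theorem 9 (classical lower bound) — VI: the three one-round bounds of the coupling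

Theorem-only support file for `ChildsEtAl2003_thm9`. Summing the fibre bounds of
`GluedTreesThm9Fibre` over the free coins and over `σ` gives, for a good view with bookkeeping
`s` and the next query `q` of the algorithm, bounds on the number of outcomes `ω = (σ, ν)` of
Game 1 consistent with the view for which the next round is bad:

* `card_bad_expansion_mul_le` (Games 3–5): if `q` is the first query of a known node `p`, the
  outcomes whose answer is NOT a good expansion answer number at most
  `weight s / 2^t · #{(c, σ) : π proper on T_s but not on T_s + p}`;
* `card_guess_mul_le` (Lemma 4): if `q` is an unknown `2n`-bit string, the outcomes answering
  it non-INVALID number at most `weight s · |V| · |Σ| / (4^n - 3t - 1)`;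
* `two_mul_card_answers_mul_ext_le` (the flow identity behind Lemma 7): the good expansion
  answers `a` are at most `C(4^n - 2E - 1 - |inv|, 2)` in number, whence
  `2 · #answers · ext (s⁺) ≤ ext s`;
* `proper_of_proper_append` (monotonicity of properness along the growth of `T`),
  `ext_addInv_le`.

## References

* [ChildsEtAl2003] A. M. Childs et al., Exponential algorithmic speedup by a quantum walk,
  STOC 2003, §4 (Lemmas 4, 7; Games 3–5).
-/

open Literature.Computability.Complexity

namespace Literature.Computability.QuantumComplexity

namespace GluedTrees

open Finset

variable {n : ℕ} {β : Type}

/-! ### Monotonicity -/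

/-- Properness of the embedding of a grown tree implies properness of the original (valid) one.
[cite: ChildsEtAl2003, §4 (Game 5)] -/
theorem proper_of_proper_append (σ : CycleDatum n) {par : List ℕ} (ex : List ℕ) (c : ℕ → Bool)
    (hval : ∀ i (h : i < par.length), par[i] ≤ 2 * i) (h : Proper σ (par ++ ex) c) : Proper σ par c := by
  intro m hm m' hm' hmm
  simp only [Set.mem_setOf_eq] at hm hm'
  have heq : ∀ k ≤ 2 * par.length, pos σ (par ++ ex) c k = pos σ par c k := by
    intro k hk
    unfold pos
    rw [posAux_apply_of_le σ (par ++ ex) c (by simp) hk]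
    exact posAux_append σ par ex hval (fun _ _ ↦ rfl) k
  have h1 : m ∈ {k | k ≤ 2 * (par ++ ex).length} := by simp; omega
  have h2 : m' ∈ {k | k ≤ 2 * (par ++ ex).length} := by simp; omega
  exact h h1 h2 (by rw [heq m hm, heq m' hm', hmm])

/-- Recording an INVALID string does not increase `ext`. [cite: ChildsEtAl2003, §4 (Lemma 4)] -/
theorem ext_addInv_le (s : VState n) (a : Name n) : (s.addInv a).ext ≤ s.ext := by
  unfold VState.ext
  simp only [VState.E_addInv, VState.inv_addInv]
  split_ifs with h
  · apply Nat.descFactorial_le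
    have := Finset.card_le_card (Finset.subset_insert a s.inv)
    omega
  · exact le_rfl

/-- `ext` of an expansion does not depend on the fresh pair. [folklore] -/
theorem ext_expand (s : VState n) (m : ℕ) (F : Finset (Name n)) (d : Name n) :
    (s.expand m F d).ext = if 2 * s.E + 3 ≤ Fintype.card (Vertex n) then
      (4 ^ n - (2 * s.E + 3 + s.inv.card)).descFactorial (Fintype.card (Vertex n) - (2 * s.E + 3)) else 0 := by
  unfold VState.ext
  simp only [VState.E_expand, VState.inv_expand]
  have : 2 * (s.E + 1) + 1 = 2 * s.E + 3 := by ring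
  rw [this]

/-! ### Sums over outcomes -/

/-- Counting outcomes `(σ, ν)` fibrewise over `σ`. [folklore] -/
theorem card_filter_outcome_eq_sum (P : Outcome n → Prop) [DecidablePred P] :
    (Finset.univ.filter P).card = ∑ σ : CycleDatum n, (Finset.univ.filter (fun ν : Naming n ↦ P (σ, ν))).card := by
  simp only [Finset.card_filter]
  rw [Fintype.sum_prod_type]

/-- Counting pairs (coins, `σ`) fibrewise over `σ`. [folklore] -/
theorem card_filter_coins_eq_sum (t : ℕ) (P : (Fin t → Bool) × CycleDatum n → Prop) [DecidablePred P] :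
    (Finset.univ.filter P).card =
      ∑ σ : CycleDatum n, (Finset.univ.filter (fun c : Fin t → Bool ↦ P (c, σ))).card := by
  simp only [Finset.card_filter]
  rw [Fintype.sum_prod_type_right]

/-! ### The bad-expansion bound -/

/-- Arithmetic of the bad-expansion bound. [folklore] -/
private theorem arith_bad {a c e t E : ℕ} (hE : E ≤ t) (h : 2 ^ (t - E) * a ≤ e * c) :
    a * 2 ^ t ≤ e * 2 ^ E * c := by
  have h2 : 2 ^ t = 2 ^ (t - E) * 2 ^ E := by rw [← pow_add, Nat.sub_add_cancel hE]
  rw [h2]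
  calc a * (2 ^ (t - E) * 2 ^ E) = 2 ^ (t - E) * a * 2 ^ E := by ring
    _ ≤ e * c * 2 ^ E := Nat.mul_le_mul_right _ h
    _ = e * 2 ^ E * c := by ring

/-- Arithmetic of the guess bound. [folklore] -/
private theorem arith_guess {a D V e t E : ℕ} (hE : E ≤ t) (h : 2 ^ (t - E) * a * D ≤ 2 ^ t * (V * e)) :
    a * D ≤ V * (e * 2 ^ E) := by
  have h2 : 2 ^ t = 2 ^ (t - E) * 2 ^ E := by rw [← pow_add, Nat.sub_add_cancel hE]
  rw [h2] at h
  have hpos : 0 < 2 ^ (t - E) := Nat.two_pow_pos _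
  apply Nat.le_of_mul_le_mul_left _ hpos
  calc 2 ^ (t - E) * (a * D) = 2 ^ (t - E) * a * D := by ring
    _ ≤ 2 ^ (t - E) * 2 ^ E * (V * e) := h
    _ = 2 ^ (t - E) * (V * (e * 2 ^ E)) := by ring

section Bounds

open scoped Classical

/-- **Bad expansions are charged to improper embeddings, fibre over `σ`** (Games 3 → 5). For a
good view `s` whose next query `q` is the first query of the known node `p` and a fixed `σ`,
the consistent namings whose answer to `q` is not a good expansion answer satisfy
`2^(t-E) · #bad_σ ≤ ext s · #{c : Proper σ par ĉ ∧ ¬ Proper σ (par ++ [p]) ĉ}`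
(`ĉ` = the coin vector `c : Fin t → Bool` extended by `false`). [cite: ChildsEtAl2003, §4 (Lemma 7)] -/
theorem card_bad_expansion_fibre_le (hn : 1 ≤ n) (σ : CycleDatum n) (M : OracleAlg β) (x : List Bool)
    {as : List (List Bool)} {s : VState n} (hs : viewState M x as = some s) (t : ℕ) (ht : s.E ≤ t)
    {q : List Bool} (hq : q.length = 2 * n) {p : ℕ} (hp : s.nodeOf? (nameOfStr n q) = some p) (hmem : p ∉ s.par) :
    2 ^ (t - s.E) * (Finset.univ.filter fun ν : Naming n ↦
        Cons M x (strOracle σ ν.1) as ∧ s.stepState q (strOracle σ ν.1 q) = none).card ≤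
      s.ext * (Finset.univ.filter fun c : Fin t → Bool ↦
        Proper σ s.par (fun i ↦ if h : i < t then c ⟨i, h⟩ else false) ∧
          ¬ Proper σ (s.par ++ [p]) (fun i ↦ if h : i < t then c ⟨i, h⟩ else false)).card := by
  set A := Finset.univ.filter (fun ν : Naming n ↦
    Cons M x (strOracle σ ν.1) as ∧ s.stepState q (strOracle σ ν.1 q) = none) with hA
  rw [← sum_card_filter_agree A t s.E ht (fun ν j ↦ coinsOf σ ν.1 s j), Finset.card_filter, Finset.mul_sum]
  apply Finset.sum_le_sum
  intro c _
  set Ac := A.filter (fun ν ↦ ∀ j : Fin t, (j : ℕ) < s.E → coinsOf σ ν.1 s j = c j) with hAc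
  have hagree : ∀ ν ∈ Ac, Cons M x (strOracle σ ν.1) as ∧
      ∀ i < s.par.length, coinsOf σ ν.1 s i = (fun i ↦ if h : i < t then c ⟨i, h⟩ else false) i := by
    intro ν hν
    rw [hAc, Finset.mem_filter, hA, Finset.mem_filter] at hν
    refine ⟨hν.1.2.1, fun i hi ↦ ?_⟩
    have hi' : i < s.E := hi
    simp only [dif_pos (show i < t by omega)]
    exact hν.2 ⟨i, by omega⟩ hi'
  rcases Ac.eq_empty_or_nonempty with hemp | ⟨ν₀, hν₀⟩
  · rw [hemp]; simp
  · have hν₀' := hν₀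
    rw [hAc, Finset.mem_filter, hA, Finset.mem_filter] at hν₀'
    have hprop := proper_of_cons hn σ ν₀.1 ν₀.2 M x hs hν₀'.1.2.1 (hagree ν₀ hν₀).2
    have hnprop := not_proper_append_of_stepState_none hn σ ν₀.1 ν₀.2 M x hs hν₀'.1.2.1 hq hp hmem
      hν₀'.1.2.2 (hagree ν₀ hν₀).2
    rw [if_pos ⟨hprop, hnprop⟩, mul_one]
    exact card_fibre_le_ext hn σ M x hs _ Ac hagree

/-- **Bad expansions are charged to improper embeddings** (Games 3 → 5), summed over `σ`:
`#bad · 2^t ≤ weight s · #{(c, σ) : Proper σ par ĉ ∧ ¬ Proper σ (par ++ [p]) ĉ}`.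
[cite: ChildsEtAl2003, §4 (Lemma 7)] -/
theorem card_bad_expansion_mul_le (hn : 1 ≤ n) (M : OracleAlg β) (x : List Bool) {as : List (List Bool)}
    {s : VState n} (hs : viewState M x as = some s) (t : ℕ) (ht : s.E ≤ t)
    {q : List Bool} (hq : q.length = 2 * n) {p : ℕ} (hp : s.nodeOf? (nameOfStr n q) = some p) (hmem : p ∉ s.par) :
    (Finset.univ.filter fun ω : Outcome n ↦
        Cons M x (strOracle ω.1 ω.2.1) as ∧ s.stepState q (strOracle ω.1 ω.2.1 q) = none).card * 2 ^ t ≤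
      s.weight * (Finset.univ.filter fun cσ : (Fin t → Bool) × CycleDatum n ↦
        Proper cσ.2 s.par (fun i ↦ if h : i < t then cσ.1 ⟨i, h⟩ else false) ∧
          ¬ Proper cσ.2 (s.par ++ [p]) (fun i ↦ if h : i < t then cσ.1 ⟨i, h⟩ else false)).card := by
  rw [card_filter_outcome_eq_sum, card_filter_coins_eq_sum, Finset.sum_mul, Finset.mul_sum]
  apply Finset.sum_le_sum
  intro σ _
  unfold VState.weight
  exact arith_bad ht (card_bad_expansion_fibre_le hn σ M x hs t ht hq hp hmem)

/-! ### The guess bound -/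

/-- **Lucky guesses are rare, fibre over `σ`** (Lemma 4: "The chance that `A` can discover the
name of a vertex that it is not told by the oracle is at most `t (2^{n+2} - 2)/2^{2n}`"). For a
good view of at most `t` rounds whose next query `q` is an unknown `2n`-bit string and a fixed
`σ`, `2^(t-E) · #guess_σ · (4^n - (3t+1)) ≤ 2^t · |V| · ext s`. [cite: ChildsEtAl2003, §4 (Lemma 4)] -/
theorem card_guess_fibre_mul_le (hn : 1 ≤ n) (σ : CycleDatum n) (M : OracleAlg β) (x : List Bool)
    {as : List (List Bool)} {s : VState n} (hs : viewState M x as = some s) (t : ℕ) (ht : as.length ≤ t)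
    {q : List Bool} (hq : q.length = 2 * n) (hp : s.nodeOf? (nameOfStr n q) = none) :
    2 ^ (t - s.E) * (Finset.univ.filter fun ν : Naming n ↦
        Cons M x (strOracle σ ν.1) as ∧ strOracle σ ν.1 q ≠ []).card * (4 ^ n - (3 * t + 1)) ≤
      2 ^ t * (Fintype.card (Vertex n) * s.ext) := by
  obtain ⟨-, -, -, hcount, -⟩ := viewState_wf M x as s hs
  have hE : s.E ≤ t := by omega
  have hQ : 2 * s.E + 1 + s.inv.card ≤ 3 * t + 1 := by omega
  set A := Finset.univ.filter (fun ν : Naming n ↦ Cons M x (strOracle σ ν.1) as ∧ strOracle σ ν.1 q ≠ []) with hA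
  rw [← sum_card_filter_agree A t s.E hE (fun ν j ↦ coinsOf σ ν.1 s j), Finset.sum_mul]
  have hfib : ∀ c : Fin t → Bool,
      (A.filter (fun ν ↦ ∀ j : Fin t, (j : ℕ) < s.E → coinsOf σ ν.1 s j = c j)).card * (4 ^ n - (3 * t + 1)) ≤
        Fintype.card (Vertex n) * s.ext := by
    intro c
    set Ac := A.filter (fun ν ↦ ∀ j : Fin t, (j : ℕ) < s.E → coinsOf σ ν.1 s j = c j) with hAc
    by_cases hqinv : nameOfStr n q ∈ s.inv
    · -- a string already answered INVALID is never a name: `Ac` is empty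
      have : Ac = ∅ := by
        rw [Finset.eq_empty_iff_forall_notMem]
        intro ν hν
        rw [hAc, Finset.mem_filter, hA, Finset.mem_filter] at hν
        obtain ⟨-, R2, -⟩ := realizes hn σ ν.1 ν.2 M x as s hs hν.1.2.1
        obtain ⟨v, hv, -⟩ := guess_vertex hn σ ν.1 ν.2 M x hs hν.1.2.1 hq hp hν.1.2.2
        exact R2 _ hqinv v hv
      rw [this]; simp
    have hagree : ∀ ν ∈ Ac, Cons M x (strOracle σ ν.1) as ∧
        (∀ i < s.par.length, coinsOf σ ν.1 s i = (fun i ↦ if h : i < t then c ⟨i, h⟩ else false) i) ∧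
        ∃ v, ν.1 v = nameOfStr n q := by
      intro ν hν
      rw [hAc, Finset.mem_filter, hA, Finset.mem_filter] at hν
      refine ⟨hν.1.2.1, fun i hi ↦ ?_, ?_⟩
      · have hi' : i < s.E := hi
        simp only [dif_pos (show i < t by omega)]
        exact hν.2 ⟨i, by omega⟩ hi'
      · obtain ⟨v, hv, -⟩ := guess_vertex hn σ ν.1 ν.2 M x hs hν.1.2.1 hq hp hν.1.2.2
        exact ⟨v, hv⟩
    have h1 := card_fibre_guess_mul_le hn σ M x hs _ (nameOfStr n q) hp hqinv Ac hagree
    calc Ac.card * (4 ^ n - (3 * t + 1)) ≤ Ac.card * (4 ^ n - (2 * s.E + 1 + s.inv.card)) :=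
          Nat.mul_le_mul_left _ (by omega)
      _ ≤ (Fintype.card (Vertex n) - (2 * s.E + 1)) * s.ext := h1
      _ ≤ Fintype.card (Vertex n) * s.ext := Nat.mul_le_mul_right _ (Nat.sub_le _ _)
  have hsum := Finset.sum_le_sum (fun c (_ : c ∈ (Finset.univ : Finset (Fin t → Bool))) ↦ hfib c)
  rw [Finset.sum_const, Finset.card_univ, smul_eq_mul, Fintype.card_fun, Fintype.card_fin,
    Fintype.card_bool] at hsum
  exact hsum

/-- **Lucky guesses are rare** (Lemma 4), summed over `σ`:
`#guess · (4^n - (3t+1)) ≤ |V| · weight s · |Σ|`. [cite: ChildsEtAl2003, §4 (Lemma 4)] -/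
theorem card_guess_mul_le (hn : 1 ≤ n) (M : OracleAlg β) (x : List Bool) {as : List (List Bool)}
    {s : VState n} (hs : viewState M x as = some s) (t : ℕ) (ht : as.length ≤ t)
    {q : List Bool} (hq : q.length = 2 * n) (hp : s.nodeOf? (nameOfStr n q) = none) :
    (Finset.univ.filter fun ω : Outcome n ↦
        Cons M x (strOracle ω.1 ω.2.1) as ∧ strOracle ω.1 ω.2.1 q ≠ []).card * (4 ^ n - (3 * t + 1)) ≤
      Fintype.card (Vertex n) * s.weight * Fintype.card (CycleDatum n) := by
  obtain ⟨-, -, -, hcount, -⟩ := viewState_wf M x as s hs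
  have hE : s.E ≤ t := by omega
  rw [card_filter_outcome_eq_sum, Finset.sum_mul]
  have : Fintype.card (Vertex n) * s.weight * Fintype.card (CycleDatum n) =
      ∑ _σ : CycleDatum n, Fintype.card (Vertex n) * s.weight := by
    rw [Finset.sum_const, Finset.card_univ, smul_eq_mul]; ring
  rw [this]
  apply Finset.sum_le_sum
  intro σ _
  unfold VState.weight
  exact arith_guess hE (card_guess_fibre_mul_le hn σ M x hs t ht hq hp)

end Bounds

/-! ### The flow identity -/

/-- **Good expansion answers are determined by their fresh pair**, a `2`-subset of the names
that are neither labels nor INVALID; hence `2 · #answers · ext s⁺ ≤ ext s` (with equality of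
the underlying falling factorials). [cite: ChildsEtAl2003, §4 (Lemma 7)] -/
theorem two_mul_card_answers_mul_ext_le (M : OracleAlg β) (x : List Bool) {as : List (List Bool)}
    {s : VState n} (hs : viewState M x as = some s)
    {q : List Bool} (hq : q.length = 2 * n) {p : ℕ} (hp : s.nodeOf? (nameOfStr n q) = some p) (hmem : p ∉ s.par)
    (AS : Finset (List Bool)) (hAS : ∀ a ∈ AS, ∃ s', s.stepState q a = some s')
    (F₀ : Finset (Name n)) (d₀ : Name n) :
    2 * AS.card * (s.expand p F₀ d₀).ext ≤ s.ext := by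
  classical
  obtain ⟨⟨hnd, hval⟩, hinj, hdis, -, -⟩ := viewState_wf M x as s hs
  set Q := (Finset.range (2 * s.E + 1)).image s.label ∪ s.inv with hQ
  have hLinj : Set.InjOn s.label ↑(Finset.range (2 * s.E + 1)) := by
    intro m hm m' hm' h
    simp only [Finset.coe_range, Set.mem_Iio] at hm hm'
    exact hinj m (by omega) m' (by omega) h
  have hQcard : Q.card = 2 * s.E + 1 + s.inv.card := by
    rw [hQ, Finset.card_union_of_disjoint, Finset.card_image_of_injOn hLinj, Finset.card_range]
    rw [Finset.disjoint_left]
    intro a ha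
    rw [Finset.mem_image] at ha
    obtain ⟨m, hm, rfl⟩ := ha
    rw [Finset.mem_range] at hm
    exact hdis m (by omega)
  -- each answer is an expansion answer; extract its fresh pair
  have hexp : ∀ a ∈ AS, ∃ L, decL n a = some L ∧ L = canon L.toFinset ∧ (s.freshSet p L).card = 2 ∧
      (p ≠ 0 → s.label (s.parentNode p) ∈ L.toFinset) ∧ (∀ b ∈ s.freshSet p L, s.nodeOf? b = none ∧ b ∉ s.inv) := by
    intro a ha
    obtain ⟨s', hs'⟩ := hAS a ha
    rcases VState.stepState_cases hs' with ⟨hql, -, -⟩ | ⟨-, m, hm, hmp, -, -⟩ |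
        ⟨-, m, L, hm, -, hL, hcanon, hcard, hparent, hfresh, -⟩ | ⟨-, hm, -, -⟩
    · exact absurd hq hql
    · rw [hp] at hm; cases hm; exact absurd hmp hmem
    · rw [hp] at hm; cases hm
      exact ⟨L, hL, hcanon, hcard, hparent, hfresh⟩
    · rw [hp] at hm; cases hm
  -- the map answer ↦ fresh pair is injective into the 2-subsets of `Qᶜ`
  let fr : List Bool → Finset (Name n) := fun a ↦ if h : a ∈ AS then s.freshSet p (hexp a h).choose else ∅
  have hfr_mem : ∀ a ∈ AS, fr a ∈ Finset.powersetCard 2 Qᶜ := by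
    intro a ha
    obtain ⟨hL, hcanon, hcard, hparent, hfresh⟩ := (hexp a ha).choose_spec
    simp only [fr, dif_pos ha]
    rw [Finset.mem_powersetCard]
    refine ⟨fun b hb ↦ ?_, hcard⟩
    rw [Finset.mem_compl, hQ, Finset.mem_union, Finset.mem_image, not_or]
    obtain ⟨h1, h2⟩ := hfresh b hb
    refine ⟨?_, h2⟩
    rintro ⟨m, hm, rfl⟩
    rw [Finset.mem_range] at hm
    exact VState.nodeOf?_eq_none.mp h1 m (by omega) rfl
  have hfr_inj : Set.InjOn fr ↑AS := by
    intro a ha a' ha' h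
    simp only [Finset.mem_coe] at ha ha'
    obtain ⟨hL, hcanon, hcard, hparent, hfresh⟩ := (hexp a ha).choose_spec
    obtain ⟨hL', hcanon', hcard', hparent', hfresh'⟩ := (hexp a' ha').choose_spec
    simp only [fr, dif_pos ha, dif_pos ha'] at h
    set L := (hexp a ha).choose with hLdef
    set L' := (hexp a' ha').choose with hL'def
    -- the name sets agree
    have hset : L.toFinset = L'.toFinset := by
      unfold VState.freshSet at h
      by_cases hp0 : p = 0
      · simpa [hp0] using h
      · simp only [hp0, if_false] at h
        rw [← Finset.insert_erase (List.mem_toFinset.mpr (List.mem_toFinset.mp (hparent hp0))),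
          ← Finset.insert_erase (List.mem_toFinset.mpr (List.mem_toFinset.mp (hparent' hp0))), h]
    rw [← encL_of_decL_eq_some hL, ← encL_of_decL_eq_some hL', hcanon, hcanon', hset]
  have hcardAS : AS.card ≤ (4 ^ n - Q.card).choose 2 := by
    have h1 := Finset.card_le_card_of_injOn fr hfr_mem hfr_inj
    rw [Finset.card_powersetCard, Finset.card_compl] at h1
    convert h1 using 2
    rw [Fintype.card_fun, Fintype.card_fin, Fintype.card_bool, pow_mul]; norm_num
  -- arithmetic
  rw [ext_expand]
  unfold VState.ext
  split_ifs with h3 h1 h1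
  · set N := 4 ^ n - Q.card with hN
    have hN' : 4 ^ n - (2 * s.E + 3 + s.inv.card) = N - 2 := by rw [hN, hQcard]; omega
    have hN'' : 4 ^ n - (2 * s.E + 1 + s.inv.card) = N := by rw [hN, hQcard]
    set R := Fintype.card (Vertex n) - (2 * s.E + 1) with hR
    have hR' : Fintype.card (Vertex n) - (2 * s.E + 3) = R - 2 := by omega
    have hR2 : 2 ≤ R := by omega
    rw [hN', hN'', hR']
    calc 2 * AS.card * (N - 2).descFactorial (R - 2) ≤ 2 * N.choose 2 * (N - 2).descFactorial (R - 2) := by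
          gcongr
      _ = N * (N - 1) * (N - 2).descFactorial (R - 2) := by
          rw [Nat.choose_two_right, Nat.mul_div_cancel' (Nat.even_mul_pred_self N).two_dvd]
      _ ≤ N.descFactorial R := by
          rcases Nat.lt_or_ge N 2 with hlt | hge
          · interval_cases N <;> simp
          · apply le_of_eq
            have key1 := Nat.succ_descFactorial_succ (N - 1) (R - 1)
            have key2 := Nat.succ_descFactorial_succ (N - 2) (R - 2)
            rw [Nat.sub_add_cancel (by omega : 1 ≤ N), Nat.sub_add_cancel (by omega : 1 ≤ R)] at key1
            rw [show N - 2 + 1 = N - 1 by omega, show R - 2 + 1 = R - 1 by omega] at key2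
            rw [key1, key2]
            ring
  · omega
  · simp
  · simp

end GluedTrees

end Literature.Computability.QuantumComplexity

/-!
# Glued trees, Theorem 9 (classical lower bound) — VII: Game 1 ≤ Game 5 (the master inequality)

Theorem-only support file for `ChildsEtAl2003_thm9`. This file assembles Lemmas 4–7 of the
source (pp. 11–12) into one rigorous inequality — the reduction of the real interaction (Game 1)
to the random embedding (Game 5):

`findProb_le_of_improper_bound`: for `1 ≤ n`, `3t + 1 < 4^n` and any `B` bounding, for every
valid expansion list `par` of length `≤ t`, the number of pairs (coins, `σ`) whose embedding
`pos σ par ĉ` is improper,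

  `findProb n M x t ≤ t · |V| / (4^n - 3t - 1) + B / (2^t · |Σ|)`,

i.e. "P(win Game 1) ≤ P(guess) + max_T P(π improper on T)" with the printed guess term
`t (2^{n+2} - 2) / 2^{2n}` (Lemma 4) in the slightly weaker form `t |V| / (4^n - 3t - 1)`.

The proof is the induction `main_induction` on the remaining rounds `k`, over good views `as`
(bookkeeping `s`), of the invariant

  `#{ω : Cons ω as ∧ EXIT's name among the next k queries} · 2^t · D
      ≤ weight s · (k · |V| · 2^t · |Σ| + D · B)`,  `D = 4^n - (3t+1)`,

where `B` bounds `#{(c, σ) : Proper σ s.par ĉ ∧ ¬ Proper σ par' ĉ}` over all valid `par'`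
growing `s.par` by at most `k` expansions. One round is split by the kind of the next query
(`GluedTreesThm9Fibre.next_*`): wrong length / repeated / INVALID rounds keep the state (the
INVALID one pays the guess term, `card_guess_mul_le`), an expansion round pays
`#{Proper T ∧ ¬ Proper (T + p)}` (`card_bad_expansion_mul_le`) and branches over the good
answers, whose weights add up to at most the weight of `s` (`two_mul_card_answers_mul_ext_le`),
the bad sets telescoping along `T ⊆ T + p ⊆ T'` (`proper_of_proper_append`).

## References

* [ChildsEtAl2003] A. M. Childs et al., Exponential algorithmic speedup by a quantum walk,
  STOC 2003, §4 (Games 1–5, Lemmas 4–7).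
-/

open Literature.Computability.Complexity

namespace Literature.Computability.QuantumComplexity

namespace GluedTrees

open Finset
open scoped Classical

variable {n : ℕ} {β : Type}

/-! ### Small helpers -/

/-- Appending a new existing node to a valid expansion list keeps it valid. [folklore] -/
theorem validPar_append_singleton {par : List ℕ} (h : ValidPar par) {p : ℕ} (hp : p ∉ par)
    (hle : p ≤ 2 * par.length) : ValidPar (par ++ [p]) := by
  refine ⟨List.nodup_append.mpr ⟨h.1, List.nodup_singleton _,
    fun a ha b hb hab ↦ hp (by simp at hb; rw [← hb, ← hab]; exact ha)⟩, ?_⟩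
  intro j hj
  simp only [List.length_append, List.length_singleton] at hj
  rcases Nat.lt_or_ge j par.length with hlt | hge
  · rw [List.getElem_append_left hlt]; exact h.2 j hlt
  · obtain rfl : j = par.length := by omega
    rw [List.getElem_concat_length rfl]; exact hle

/-- A prefix of a valid expansion list is valid. [folklore] -/
theorem validPar_of_prefix {par par' : List ℕ} (h : par <+: par') (hv : ValidPar par') : ValidPar par := by
  obtain ⟨ex, rfl⟩ := h
  refine ⟨(List.nodup_append.mp hv.1).1, fun j hj ↦ ?_⟩
  have := hv.2 j (by simp; omega)
  rwa [List.getElem_append_left hj] at this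

/-- **Telescoping of the bad sets.** Along `T ⊆ T + p ⊆ T'`,
`#{Proper T ∧ ¬Proper (T+p)} + #{Proper (T+p) ∧ ¬Proper T'} ≤ #{Proper T ∧ ¬Proper T'}`.
[cite: ChildsEtAl2003, §4 (Lemma 8, "Overall we have shown")] -/
theorem card_bad_add_card_bad_le (t : ℕ) {par : List ℕ} (p : ℕ) {par'' : List ℕ}
    (hval : ValidPar (par ++ [p])) (hpre : par ++ [p] <+: par'') :
    (Finset.univ.filter fun cσ : (Fin t → Bool) × CycleDatum n ↦
        Proper cσ.2 par (fun i ↦ if h : i < t then cσ.1 ⟨i, h⟩ else false) ∧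
          ¬ Proper cσ.2 (par ++ [p]) (fun i ↦ if h : i < t then cσ.1 ⟨i, h⟩ else false)).card +
      (Finset.univ.filter fun cσ : (Fin t → Bool) × CycleDatum n ↦
        Proper cσ.2 (par ++ [p]) (fun i ↦ if h : i < t then cσ.1 ⟨i, h⟩ else false) ∧
          ¬ Proper cσ.2 par'' (fun i ↦ if h : i < t then cσ.1 ⟨i, h⟩ else false)).card ≤
      (Finset.univ.filter fun cσ : (Fin t → Bool) × CycleDatum n ↦
        Proper cσ.2 par (fun i ↦ if h : i < t then cσ.1 ⟨i, h⟩ else false) ∧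
          ¬ Proper cσ.2 par'' (fun i ↦ if h : i < t then cσ.1 ⟨i, h⟩ else false)).card := by
  obtain ⟨ex, rfl⟩ := hpre
  have hval0 : ∀ i (h : i < par.length), par[i] ≤ 2 * i :=
    (validPar_of_prefix (List.prefix_append par [p]) hval).2
  rw [← Finset.card_union_of_disjoint]
  · apply Finset.card_le_card
    intro cσ h
    rw [Finset.mem_union, Finset.mem_filter, Finset.mem_filter] at h
    rw [Finset.mem_filter]
    rcases h with ⟨-, h1, h2⟩ | ⟨-, h1, h2⟩
    · exact ⟨Finset.mem_univ _, h1, fun h3 ↦ h2 (proper_of_proper_append cσ.2 ex _ hval.2 h3)⟩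
    · exact ⟨Finset.mem_univ _, proper_of_proper_append cσ.2 [p] _ hval0 h1, h2⟩
  · rw [Finset.disjoint_left]
    intro cσ h1 h2
    rw [Finset.mem_filter] at h1 h2
    exact h1.2.2 h2.2.1

/-! ### The main induction -/

/-- **Main induction (Games 1–5, Lemmas 4–7).** See the module docstring.
[cite: ChildsEtAl2003, §4 (Lemmas 4–7)] -/
theorem main_induction (hn : 1 ≤ n) (M : OracleAlg β) (x : List Bool) (t : ℕ) :
    ∀ (k : ℕ) (as : List (List Bool)) (s : VState n), viewState M x as = some s → as.length + k ≤ t →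
      ∀ B : ℕ, (∀ par' : List ℕ, s.par <+: par' → ValidPar par' → par'.length ≤ s.par.length + k →
        (Finset.univ.filter fun cσ : (Fin t → Bool) × CycleDatum n ↦
          Proper cσ.2 s.par (fun i ↦ if h : i < t then cσ.1 ⟨i, h⟩ else false) ∧
            ¬ Proper cσ.2 par' (fun i ↦ if h : i < t then cσ.1 ⟨i, h⟩ else false)).card ≤ B) →
      (Finset.univ.filter fun ω : Outcome n ↦ Cons M x (strOracle ω.1 ω.2.1) as ∧
          List.ofFn (ω.2.1 (exit n)) ∈ M.queriesAux (strOracle ω.1 ω.2.1) x k as).card *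
        2 ^ t * (4 ^ n - (3 * t + 1)) ≤
      s.weight * (k * Fintype.card (Vertex n) * 2 ^ t * Fintype.card (CycleDatum n) + (4 ^ n - (3 * t + 1)) * B) := by
  intro k
  induction k with
  | zero =>
    intro as s hs hlen B hB
    have : (Finset.univ.filter fun ω : Outcome n ↦ Cons M x (strOracle ω.1 ω.2.1) as ∧
        List.ofFn (ω.2.1 (exit n)) ∈ M.queriesAux (strOracle ω.1 ω.2.1) x 0 as) = ∅ := by
      rw [Finset.eq_empty_iff_forall_notMem]
      intro ω h
      rw [Finset.mem_filter] at h
      simp at h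
    rw [this]; simp
  | succ k ih =>
    intro as s hs hlen B hB
    set D := 4 ^ n - (3 * t + 1) with hD
    set V := Fintype.card (Vertex n) with hV
    set Sg := Fintype.card (CycleDatum n) with hSg
    -- the counted set
    set S := Finset.univ.filter (fun ω : Outcome n ↦ Cons M x (strOracle ω.1 ω.2.1) as ∧
        List.ofFn (ω.2.1 (exit n)) ∈ M.queriesAux (strOracle ω.1 ω.2.1) x (k + 1) as) with hSdef
    cases hq : M.step x as with
    | inr b =>
      have : S = ∅ := by
        rw [Finset.eq_empty_iff_forall_notMem]
        intro ω h
        rw [hSdef, Finset.mem_filter, queriesAux_succ_eq, hq] at h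
        simp at h
      rw [this]; simp
    | inl q =>
      -- the transfer lemma for rounds that every consistent outcome answers by the SAME good answer
      have transfer : ∀ a₀ : List Bool, (∀ ω : Outcome n, Cons M x (strOracle ω.1 ω.2.1) as →
            strOracle ω.1 ω.2.1 q = a₀ ∧ q ≠ List.ofFn (ω.2.1 (exit n))) →
          ∀ s' : VState n, s.stepState q a₀ = some s' → s'.par = s.par → s'.weight ≤ s.weight →
          S.card * 2 ^ t * D ≤ s.weight * ((k + 1) * V * 2 ^ t * Sg + D * B) := by
        intro a₀ ha₀ s' hst hpar hw
        set S' := Finset.univ.filter (fun ω : Outcome n ↦ Cons M x (strOracle ω.1 ω.2.1) (as ++ [a₀]) ∧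
          List.ofFn (ω.2.1 (exit n)) ∈ M.queriesAux (strOracle ω.1 ω.2.1) x k (as ++ [a₀])) with hS'def
        have hsub : S ⊆ S' := by
          intro ω hω
          rw [hSdef, Finset.mem_filter] at hω
          obtain ⟨-, hcons, hmem⟩ := hω
          obtain ⟨hO, hne⟩ := ha₀ ω hcons
          rw [queriesAux_succ_eq, hq] at hmem
          simp only [List.mem_cons] at hmem
          rcases hmem with h | h
          · exact absurd h.symm hne
          rw [hO] at h
          rw [hS'def, Finset.mem_filter]
          exact ⟨Finset.mem_univ _, (cons_append_singleton_iff M x _ as a₀).mpr ⟨hcons, q, hq, hO⟩, h⟩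
        have hs' : viewState M x (as ++ [a₀]) = some s' := by
          rw [viewState_append_singleton, hs, Option.bind_some, hq]; exact hst
        have hB' : ∀ par' : List ℕ, s'.par <+: par' → ValidPar par' → par'.length ≤ s'.par.length + k →
            (Finset.univ.filter fun cσ : (Fin t → Bool) × CycleDatum n ↦
              Proper cσ.2 s'.par (fun i ↦ if h : i < t then cσ.1 ⟨i, h⟩ else false) ∧
                ¬ Proper cσ.2 par' (fun i ↦ if h : i < t then cσ.1 ⟨i, h⟩ else false)).card ≤ B := by
          rw [hpar]
          intro par' h1 h2 h3
          exact hB par' h1 h2 (by omega)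
        have h := ih (as ++ [a₀]) s' hs' (by simp; omega) B hB'
        calc S.card * 2 ^ t * D ≤ S'.card * 2 ^ t * D := by
              gcongr
          _ ≤ s'.weight * (k * V * 2 ^ t * Sg + D * B) := h
          _ ≤ s.weight * (k * V * 2 ^ t * Sg + D * B) := Nat.mul_le_mul_right _ hw
          _ ≤ s.weight * ((k + 1) * V * 2 ^ t * Sg + D * B) := by
              apply Nat.mul_le_mul_left; gcongr; omega
      by_cases hql : q.length = 2 * n
      swap
      · -- a query of the wrong length: answered `[]`, state unchanged
        refine transfer [] (fun ω hcons ↦ ?_) s (VState.stepState_of_length_ne s hql) rfl le_rfl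
        obtain ⟨hO, hne, -⟩ := next_of_length_ne (s := s) ω.1 ω.2.1 hql
        exact ⟨hO, hne⟩
      set qa := nameOfStr n q with hqa
      cases hnode : s.nodeOf? qa with
      | some p =>
        by_cases hpm : p ∈ s.par
        · -- a repeated query: answered by the recorded answer, state unchanged
          refine transfer (encL (canon (s.answerSet (s.par.idxOf p) p))) (fun ω hcons ↦ ?_) s
            (VState.stepState_of_mem_par s hql hnode hpm) rfl le_rfl
          obtain ⟨hO, hne, -⟩ := next_of_mem_par hn ω.1 ω.2.1 ω.2.2 M x hs hcons hql hnode hpm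
          exact ⟨hO, hne⟩
        · -- an EXPANSION of node `p`
          obtain ⟨hpE, -⟩ := VState.nodeOf?_eq_some hnode
          obtain ⟨⟨hnd, hval⟩, -, -, hcount, -⟩ := viewState_wf M x as s hs
          have hEt : s.E ≤ t := by omega
          set Bad := Finset.univ.filter (fun ω : Outcome n ↦ Cons M x (strOracle ω.1 ω.2.1) as ∧
            s.stepState q (strOracle ω.1 ω.2.1 q) = none) with hBad
          set Rest := Finset.univ.filter (fun ω : Outcome n ↦ Cons M x (strOracle ω.1 ω.2.1) as ∧
            s.stepState q (strOracle ω.1 ω.2.1 q) ≠ none ∧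
            List.ofFn (ω.2.1 (exit n)) ∈ M.queriesAux (strOracle ω.1 ω.2.1) x k (as ++ [strOracle ω.1 ω.2.1 q]))
            with hRest
          have hsub : S ⊆ Bad ∪ Rest := by
            intro ω hω
            rw [hSdef, Finset.mem_filter] at hω
            obtain ⟨-, hcons, hmem⟩ := hω
            rw [queriesAux_succ_eq, hq] at hmem
            simp only [List.mem_cons] at hmem
            rw [Finset.mem_union, hBad, hRest, Finset.mem_filter, Finset.mem_filter]
            cases hst : s.stepState q (strOracle ω.1 ω.2.1 q) with
            | none => exact Or.inl ⟨Finset.mem_univ _, hcons, rfl⟩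
            | some s' =>
              right
              refine ⟨Finset.mem_univ _, hcons, by simp, ?_⟩
              rcases hmem with h | h
              · exact absurd h.symm (next_expand_ne_exit hn ω.1 ω.2.1 ω.2.2 M x hs hcons hql hnode hpm hst).1
              · exact h
          -- the set of good answers
          set AS := Rest.image (fun ω : Outcome n ↦ strOracle ω.1 ω.2.1 q) with hASdef
          have hAS : ∀ a ∈ AS, ∃ s', s.stepState q a = some s' := by
            intro a ha
            rw [hASdef, Finset.mem_image] at ha
            obtain ⟨ω, hω, rfl⟩ := ha
            rw [hRest, Finset.mem_filter] at hω
            exact Option.ne_none_iff_exists'.mp hω.2.2.1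
          -- `Rest` is covered by the counted sets of the extended views
          have hRest_le : Rest.card ≤ ∑ a ∈ AS, (Finset.univ.filter (fun ω : Outcome n ↦
              Cons M x (strOracle ω.1 ω.2.1) (as ++ [a]) ∧
              List.ofFn (ω.2.1 (exit n)) ∈ M.queriesAux (strOracle ω.1 ω.2.1) x k (as ++ [a]))).card := by
            refine (Finset.card_le_card ?_).trans Finset.card_biUnion_le
            intro ω hω
            have hω' := hω
            rw [hRest, Finset.mem_filter] at hω'
            obtain ⟨-, hcons, -, hmem⟩ := hω'
            rw [Finset.mem_biUnion]
            refine ⟨strOracle ω.1 ω.2.1 q, Finset.mem_image_of_mem _ hω, ?_⟩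
            rw [Finset.mem_filter]
            exact ⟨Finset.mem_univ _, (cons_append_singleton_iff M x _ as _).mpr ⟨hcons, q, hq, rfl⟩, hmem⟩
          -- the bad set of this expansion and its budget
          set B₀ := (Finset.univ.filter fun cσ : (Fin t → Bool) × CycleDatum n ↦
            Proper cσ.2 s.par (fun i ↦ if h : i < t then cσ.1 ⟨i, h⟩ else false) ∧
              ¬ Proper cσ.2 (s.par ++ [p]) (fun i ↦ if h : i < t then cσ.1 ⟨i, h⟩ else false)).card with hB₀def
          have hvalid : ValidPar (s.par ++ [p]) := validPar_append_singleton ⟨hnd, hval⟩ hpm hpE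
          have hB₀ : B₀ ≤ B := hB (s.par ++ [p]) (List.prefix_append _ _) hvalid (by simp)
          have hBadle : Bad.card * 2 ^ t ≤ s.weight * B₀ :=
            card_bad_expansion_mul_le hn M x hs t hEt hql hnode hpm
          -- the common weight of the extended states
          set Wp := (s.expand p ∅ qa).weight with hWp
          have hWeq : ∀ a ∈ AS, ∀ s', s.stepState q a = some s' → s'.weight = Wp ∧ s'.par = s.par ++ [p] := by
            intro a ha s' hst
            rcases VState.stepState_cases hst with ⟨hql', -, -⟩ | ⟨-, m, hm, hmp, -, -⟩ |
                ⟨-, m, L, hm, -, -, -, -, -, -, rfl⟩ | ⟨-, hm, -, -⟩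
            · exact absurd hql hql'
            · rw [hnode] at hm; cases hm; exact absurd hmp hpm
            · rw [hnode] at hm; cases hm
              refine ⟨?_, VState.par_expand _ _ _ _⟩
              rw [hWp]; unfold VState.weight; rw [ext_expand, ext_expand, VState.E_expand, VState.E_expand]
            · rw [hnode] at hm; cases hm
          -- the flow: the weights of the branches add up to at most the weight of `s`
          have hflow : AS.card * Wp ≤ s.weight := by
            have := two_mul_card_answers_mul_ext_le M x hs hql hnode hpm AS hAS ∅ qa
            rw [hWp]; unfold VState.weight; rw [VState.E_expand, pow_succ]
            calc AS.card * ((s.expand p ∅ qa).ext * (2 ^ s.E * 2)) = 2 * AS.card * (s.expand p ∅ qa).ext * 2 ^ s.E := by ring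
              _ ≤ s.ext * 2 ^ s.E := Nat.mul_le_mul_right _ this
          -- the branches
          have hbranch : ∀ a ∈ AS, (Finset.univ.filter (fun ω : Outcome n ↦
              Cons M x (strOracle ω.1 ω.2.1) (as ++ [a]) ∧
              List.ofFn (ω.2.1 (exit n)) ∈ M.queriesAux (strOracle ω.1 ω.2.1) x k (as ++ [a]))).card * 2 ^ t * D ≤
              Wp * (k * V * 2 ^ t * Sg + D * (B - B₀)) := by
            intro a ha
            obtain ⟨s', hst⟩ := hAS a ha
            obtain ⟨hw, hpar⟩ := hWeq a ha s' hst
            have hs' : viewState M x (as ++ [a]) = some s' := by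
              rw [viewState_append_singleton, hs, Option.bind_some, hq]; exact hst
            have hB' : ∀ par' : List ℕ, s'.par <+: par' → ValidPar par' → par'.length ≤ s'.par.length + k →
                (Finset.univ.filter fun cσ : (Fin t → Bool) × CycleDatum n ↦
                  Proper cσ.2 s'.par (fun i ↦ if h : i < t then cσ.1 ⟨i, h⟩ else false) ∧
                    ¬ Proper cσ.2 par' (fun i ↦ if h : i < t then cσ.1 ⟨i, h⟩ else false)).card ≤ B - B₀ := by
              rw [hpar]
              intro par'' h1 h2 h3
              have htel := card_bad_add_card_bad_le (n := n) t p hvalid h1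
              have hB'' := hB par'' ((List.prefix_append _ _).trans h1) h2 (by simp at h3; omega)
              rw [← hB₀def] at htel
              omega
            rw [← hw]
            exact ih (as ++ [a]) s' hs' (by simp; omega) (B - B₀) hB'
          -- assembling
          have hRest' : Rest.card * 2 ^ t * D ≤ s.weight * (k * V * 2 ^ t * Sg + D * (B - B₀)) := by
            calc Rest.card * 2 ^ t * D ≤ (∑ a ∈ AS, (Finset.univ.filter (fun ω : Outcome n ↦
                  Cons M x (strOracle ω.1 ω.2.1) (as ++ [a]) ∧
                  List.ofFn (ω.2.1 (exit n)) ∈ M.queriesAux (strOracle ω.1 ω.2.1) x k (as ++ [a]))).card) * 2 ^ t * D := by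
                  gcongr
              _ = ∑ a ∈ AS, (Finset.univ.filter (fun ω : Outcome n ↦
                  Cons M x (strOracle ω.1 ω.2.1) (as ++ [a]) ∧
                  List.ofFn (ω.2.1 (exit n)) ∈ M.queriesAux (strOracle ω.1 ω.2.1) x k (as ++ [a]))).card * 2 ^ t * D := by
                  rw [Finset.sum_mul, Finset.sum_mul]
              _ ≤ ∑ _a ∈ AS, Wp * (k * V * 2 ^ t * Sg + D * (B - B₀)) := Finset.sum_le_sum hbranch
              _ = AS.card * Wp * (k * V * 2 ^ t * Sg + D * (B - B₀)) := by
                  rw [Finset.sum_const, smul_eq_mul]; ring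
              _ ≤ s.weight * (k * V * 2 ^ t * Sg + D * (B - B₀)) := Nat.mul_le_mul_right _ hflow
          have hDB : D * (B - B₀) + D * B₀ = D * B := by rw [← Nat.mul_add, Nat.sub_add_cancel hB₀]
          calc S.card * 2 ^ t * D ≤ (Bad.card + Rest.card) * 2 ^ t * D := by
                gcongr
                exact (Finset.card_le_card hsub).trans (Finset.card_union_le _ _)
            _ = Bad.card * 2 ^ t * D + Rest.card * 2 ^ t * D := by ring
            _ ≤ s.weight * B₀ * D + s.weight * (k * V * 2 ^ t * Sg + D * (B - B₀)) :=
                add_le_add (Nat.mul_le_mul_right _ hBadle) hRest'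
            _ = s.weight * (k * V * 2 ^ t * Sg + (D * (B - B₀) + D * B₀)) := by ring
            _ = s.weight * (k * V * 2 ^ t * Sg + D * B) := by rw [hDB]
            _ ≤ s.weight * ((k + 1) * V * 2 ^ t * Sg + D * B) := by
                apply Nat.mul_le_mul_left; gcongr; omega
      | none =>
        -- an unknown string: INVALID (state records it) or a lucky guess
        obtain ⟨-, -, -, hcount, -⟩ := viewState_wf M x as s hs
        set G := Finset.univ.filter (fun ω : Outcome n ↦ Cons M x (strOracle ω.1 ω.2.1) as ∧
          strOracle ω.1 ω.2.1 q ≠ []) with hGdef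
        set S'' := Finset.univ.filter (fun ω : Outcome n ↦ Cons M x (strOracle ω.1 ω.2.1) (as ++ [[]]) ∧
          List.ofFn (ω.2.1 (exit n)) ∈ M.queriesAux (strOracle ω.1 ω.2.1) x k (as ++ [[]])) with hS''def
        have hsub : S ⊆ G ∪ S'' := by
          intro ω hω
          rw [hSdef, Finset.mem_filter] at hω
          obtain ⟨-, hcons, hmem⟩ := hω
          rw [queriesAux_succ_eq, hq] at hmem
          simp only [List.mem_cons] at hmem
          rw [Finset.mem_union, hGdef, hS''def, Finset.mem_filter, Finset.mem_filter]
          by_cases hO : strOracle ω.1 ω.2.1 q = []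
          · right
            obtain ⟨hne, -⟩ := next_of_invalid hn ω.1 ω.2.1 (s := s) hql hnode hO
            rcases hmem with h | h
            · exact absurd h.symm hne
            · rw [hO] at h
              exact ⟨Finset.mem_univ _, (cons_append_singleton_iff M x _ as _).mpr ⟨hcons, q, hq, hO⟩, h⟩
          · exact Or.inl ⟨Finset.mem_univ _, hcons, hO⟩
        have hG : G.card * D ≤ V * s.weight * Sg := card_guess_mul_le hn M x hs t (by omega) hql hnode
        have hs'' : viewState M x (as ++ [[]]) = some (s.addInv qa) := by
          rw [viewState_append_singleton, hs, Option.bind_some, hq]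
          exact VState.stepState_of_nodeOf?_eq_none s hql hnode
        have hB'' : ∀ par' : List ℕ, (s.addInv qa).par <+: par' → ValidPar par' →
            par'.length ≤ (s.addInv qa).par.length + k →
            (Finset.univ.filter fun cσ : (Fin t → Bool) × CycleDatum n ↦
              Proper cσ.2 (s.addInv qa).par (fun i ↦ if h : i < t then cσ.1 ⟨i, h⟩ else false) ∧
                ¬ Proper cσ.2 par' (fun i ↦ if h : i < t then cσ.1 ⟨i, h⟩ else false)).card ≤ B := by
          rw [VState.par_addInv]
          intro par' h1 h2 h3
          exact hB par' h1 h2 (by omega)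
        have IH'' := ih (as ++ [[]]) (s.addInv qa) hs'' (by simp; omega) B hB''
        have hw : (s.addInv qa).weight ≤ s.weight := by
          unfold VState.weight; rw [VState.E_addInv]; exact Nat.mul_le_mul_right _ (ext_addInv_le s qa)
        calc S.card * 2 ^ t * D ≤ (G.card + S''.card) * 2 ^ t * D := by
              gcongr
              exact (Finset.card_le_card hsub).trans (Finset.card_union_le _ _)
          _ = G.card * D * 2 ^ t + S''.card * 2 ^ t * D := by ring
          _ ≤ V * s.weight * Sg * 2 ^ t + (s.addInv qa).weight * (k * V * 2 ^ t * Sg + D * B) :=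
              add_le_add (Nat.mul_le_mul_right _ hG) IH''
          _ ≤ V * s.weight * Sg * 2 ^ t + s.weight * (k * V * 2 ^ t * Sg + D * B) := by
              gcongr
          _ = s.weight * ((k + 1) * V * 2 ^ t * Sg + D * B) := by ring

/-! ### From counts to probabilities -/

/-- There are at least `(4^n - 1)_( |V| - 1 )` namings (extend an injection of the non-ENTRANCE
vertices into the nonzero names by ENTRANCE ↦ `0`). [cite: ChildsEtAl2003, §4 (Game 1)] -/
theorem descFactorial_le_card_naming (n : ℕ) :
    (4 ^ n - 1).descFactorial (Fintype.card (Vertex n) - 1) ≤ Fintype.card (Naming n) := by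
  have key : Fintype.card ({v : Vertex n // ¬ v = entrance n} ↪ {a : Name n // ¬ a = (fun _ ↦ false)}) ≤
      Fintype.card (Naming n) := by
    refine Fintype.card_le_of_injective
      (fun e ↦ (⟨⟨fun v ↦ if h : v = entrance n then (fun _ ↦ false) else (e ⟨v, h⟩).1, ?_⟩, ?_⟩ : Naming n)) ?_
    · intro v w hvw
      simp only at hvw
      by_cases hv : v = entrance n <;> by_cases hw : w = entrance n
      · rw [hv, hw]
      · rw [dif_pos hv, dif_neg hw] at hvw; exact absurd hvw.symm (e ⟨w, hw⟩).2
      · rw [dif_neg hv, dif_pos hw] at hvw; exact absurd hvw (e ⟨v, hv⟩).2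
      · rw [dif_neg hv, dif_neg hw] at hvw
        have := e.injective (Subtype.ext hvw)
        exact congrArg Subtype.val this
    · simp
    · intro e e' h
      apply DFunLike.ext
      rintro ⟨v, hv⟩
      apply Subtype.ext
      have := congrArg (fun ν : Naming n ↦ ν.1 v) h
      simpa [dif_neg hv] using this
  have hcardV' : Fintype.card {v : Vertex n // ¬ v = entrance n} = Fintype.card (Vertex n) - 1 := by
    rw [Fintype.card_subtype_compl, Fintype.card_subtype_eq]
  have hcardN' : Fintype.card {a : Name n // ¬ a = (fun _ ↦ false)} = 4 ^ n - 1 := by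
    rw [Fintype.card_subtype_compl, Fintype.card_subtype_eq, Fintype.card_fun, Fintype.card_fin,
      Fintype.card_bool, pow_mul]
    norm_num
  rw [Fintype.card_embedding_eq, hcardV', hcardN'] at key
  exact key

/-- The weight of the empty view is `(4^n - 1)_( |V| - 1 )`. [cite: ChildsEtAl2003, §4 (Lemma 7)] -/
theorem weight_init (n : ℕ) : (VState.init n).weight = (4 ^ n - 1).descFactorial (Fintype.card (Vertex n) - 1) := by
  unfold VState.weight VState.ext
  have hV : 1 ≤ Fintype.card (Vertex n) := by
    rw [card_vertex]
    have : 4 ≤ 2 ^ (n + 2) := by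
      calc 4 = 2 ^ 2 := rfl
        _ ≤ 2 ^ (n + 2) := Nat.pow_le_pow_right two_pos (by omega)
    omega
  simp [VState.E]

/-- **The master inequality (Game 1 ≤ guessing + Game 5).** For `1 ≤ n` and `3t + 1 < 4^n`,
if `B` bounds, for every valid expansion list of length at most `t`, the number of pairs
(coins `c : Fin t → Bool`, cycle datum `σ`) whose embedding is improper, then every
deterministic algorithm `(M, x)` finds the EXIT within `t` rounds with probability at most
`t · |V| / (4^n - 3t - 1) + B / (2^t · |Σ|)` — Lemma 4 (`P ≤ P' + t (2^{n+2}-2)/2^{2n}`),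
Lemmas 5–7 (`P' = P''`) and the definition of Game 5, combined. [cite: ChildsEtAl2003, §4 (Lemmas 4–7)] -/
theorem findProb_le_of_improper_bound (hn : 1 ≤ n) (M : OracleAlg β) (x : List Bool) (t : ℕ)
    (ht : 3 * t + 1 < 4 ^ n) (B : ℕ)
    (hB : ∀ par : List ℕ, ValidPar par → par.length ≤ t →
      (Finset.univ.filter fun cσ : (Fin t → Bool) × CycleDatum n ↦
        ¬ Proper cσ.2 par (fun i ↦ if h : i < t then cσ.1 ⟨i, h⟩ else false)).card ≤ B) :
    findProb n M x t ≤ t * (Fintype.card (Vertex n) : ℝ) / (4 ^ n - (3 * t + 1)) +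
      B / (2 ^ t * Fintype.card (CycleDatum n)) := by
  -- the main induction at the empty view
  have hB' : ∀ par' : List ℕ, (VState.init n).par <+: par' → ValidPar par' →
      par'.length ≤ (VState.init n).par.length + t →
      (Finset.univ.filter fun cσ : (Fin t → Bool) × CycleDatum n ↦
        Proper cσ.2 (VState.init n).par (fun i ↦ if h : i < t then cσ.1 ⟨i, h⟩ else false) ∧
          ¬ Proper cσ.2 par' (fun i ↦ if h : i < t then cσ.1 ⟨i, h⟩ else false)).card ≤ B := by
    intro par' _ hv hl
    refine (Finset.card_le_card ?_).trans (hB par' hv (by simpa using hl))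
    intro cσ h
    rw [Finset.mem_filter] at h ⊢
    exact ⟨h.1, h.2.2⟩
  have main := main_induction hn M x t t [] (VState.init n) (viewState_nil M x) (by simp) B hB'
  rw [weight_init] at main
  -- the counted set is the event `FindsExit`
  have hset : (Finset.univ.filter fun ω : Outcome n ↦ Cons M x (strOracle ω.1 ω.2.1) [] ∧
      List.ofFn (ω.2.1 (exit n)) ∈ M.queriesAux (strOracle ω.1 ω.2.1) x t []) =
      Finset.univ.filter (FindsExit M x t) := by
    apply Finset.filter_congr
    intro ω _
    simp only [cons_nil, true_and]
    rfl
  rw [hset] at main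
  -- the cardinalities involved
  have hW := descFactorial_le_card_naming n
  have hΩ : Fintype.card (Outcome n) = Fintype.card (CycleDatum n) * Fintype.card (Naming n) :=
    Fintype.card_prod _ _
  have hSgpos : 0 < Fintype.card (CycleDatum n) := Fintype.card_pos
  have hfp : findProb n M x t = ((Finset.univ.filter (FindsExit (n := n) M x t)).card : ℝ) /
      (Fintype.card (CycleDatum n) * Fintype.card (Naming n) : ℕ) := by
    unfold findProb; rw [hΩ]
  have hDreal : ((4 : ℝ) ^ n - (3 * t + 1)) = ((4 ^ n - (3 * t + 1) : ℕ) : ℝ) := by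
    rw [Nat.cast_sub ht.le]; push_cast; ring
  have hDpos : 0 < 4 ^ n - (3 * t + 1) := by omega
  rw [hfp, hDreal]
  -- abstract them into plain natural numbers
  generalize (Finset.univ.filter (FindsExit (n := n) M x t)).card = cnt at main
  generalize Fintype.card (Vertex n) = V at main hW
  generalize Fintype.card (CycleDatum n) = Sg at main hSgpos
  generalize Fintype.card (Naming n) = Nm at main hW
  generalize 4 ^ n - (3 * t + 1) = D at main hDpos
  -- pass to real numbers
  have main' : cnt * 2 ^ t * D ≤ Nm * (t * V * 2 ^ t * Sg + D * B) :=
    main.trans (Nat.mul_le_mul_right _ hW)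
  -- forget the origin of the numbers (keeps the arithmetic tactics away from `Fintype.card`)
  clear hfp hset hB hB' hΩ hDreal
  have h2t : (0 : ℝ) < 2 ^ t := pow_pos two_pos t
  have hDR : (0 : ℝ) < D := by exact_mod_cast hDpos
  have hSgR : (0 : ℝ) < Sg := by exact_mod_cast hSgpos
  rcases Nat.eq_zero_or_pos Nm with hNm0 | hNmpos
  · -- no namings (`n ≤ 1`): the probability is the junk value `0`
    rw [hNm0, mul_zero, Nat.cast_zero, div_zero]
    exact add_nonneg (div_nonneg (mul_nonneg (Nat.cast_nonneg _) (Nat.cast_nonneg _)) (Nat.cast_nonneg _))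
      (div_nonneg (Nat.cast_nonneg _) (mul_nonneg h2t.le (Nat.cast_nonneg _)))
  have mainR : (cnt : ℝ) * 2 ^ t * D ≤ Nm * (t * V * 2 ^ t * Sg + D * B) := by exact_mod_cast main'
  have hNmR : (0 : ℝ) < Nm := by exact_mod_cast hNmpos
  have hΩR : (0 : ℝ) < (Sg * Nm : ℕ) := by exact_mod_cast Nat.mul_pos hSgpos hNmpos
  rw [div_le_iff₀ hΩR]
  have key : (↑t * ↑V / ↑D + ↑B / (2 ^ t * ↑Sg)) * (↑(Sg * Nm) : ℝ) =
      Nm * (t * V * 2 ^ t * Sg + D * B) / (2 ^ t * D) := by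
    rw [div_add_div _ _ hDR.ne' (mul_pos h2t hSgR).ne', div_mul_eq_mul_div,
      div_eq_div_iff (mul_pos hDR (mul_pos h2t hSgR)).ne' (mul_pos h2t hDR).ne']
    push_cast
    ring
  rw [key, le_div_iff₀ (mul_pos h2t hDR)]
  calc (cnt : ℝ) * (2 ^ t * D) = cnt * 2 ^ t * D := by ring
    _ ≤ _ := mainR

end GluedTrees

end Literature.Computability.QuantumComplexity
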